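import Literature.Barriers.FinalStateConjecture.ExtremalHorizonUniformBoundednessFromIntegratedDecay
import HarnessLib

/-!
# Barrier catalogue `FinalStateConjecture`: `Aretakis2012_integratedDecay` follows from integrated
# local energy decay in a thin transition shell — §13.1–13.2 of Aretakis 2012 with the collar bulk
# kept (near-horizon spacetime bound of Thm. 2) and the first Hardy inequality (Cor. 13.2.1)
# (`Literature/Barriers/FinalStateConjecture/`, D-0021, D-0014; family `gr`)

Written from the proving seat of
`Literature.Barriers.FinalStateConjecture.Aretakis2012_uniformBoundedness`, descended onto the
sibling fact `Literature.Barriers.FinalStateConjecture.Aretakis2012_integratedDecay`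
(`ExtremalHorizonAxisymmetricDecayDecomposition.lean`; Aretakis, JFA 263 (2012), Thm. 2 — the
near-horizon spacetime bound `∫_{𝒜}[ψ² + (Tψ)² + (r − M)(Yψ)² + |∇̸ψ|²] ≤ C ∫_{Σ₀}J^N[ψ]·n` on
`𝒜 = {M ≤ r ≤ 23M/21}` — with Thm. 1, in shell form: `τ ↦ ∫∫∫_M^{R₂} sin θ (Φ² + (r − M)²(∂_ρΦ)²)`
integrable on `(τ₀, ∞)` for some `R₂ > M`, for every member `Φ` of the class).

`ExtremalHorizonUniformBoundednessFromIntegratedDecay.lean` proves §13.1 of the source for the class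
with the three-term integrated decay `∫₀^τ ∫₀^{2π}∫₀^π∫_A^B sin θ (Φ² + (TΦ)² + (∂_ρΦ)²) ≤ I` on a
transition shell `[A, B] ⊂ (M, 23M/21]` as hypothesis (Prop. 12.5.1 of the source restricted to the
shell), DISCARDING the bulk of the cut-off current `J^{N,δ,−1/2}` on the collar `[M, A]`, which has a
sign there (Prop. 7.2.1). **This file keeps that bulk** and so proves, from the same hypothesis,

* `Kerr.collar_timeIntegral_degRhoDeriv_sq_le_of_transitionILED₃` (**the near-horizon spacetime
  bound of Thm. 2, transversal term**): `∫₀^τ ∫₀^{2π}∫₀^π∫_M^A sin θ (r − M)²(∂_ρΦ)² ≤ C` for all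
  `τ ≥ 0` — energy identity `Kerr.mult_identity_of_class` for the cut-off current on
  `[0, τ] × [M, r₂]`, horizon flux `≥ 0`, `−bulk ≥ ¼ sin θ (r − M)(r + M)(∂_rG)² ≥ ¼ sin θ (r − M)²(∂_rG)²`
  on the collar (`neg_multBulk_nCurrent_ge`, Prop. 7.2.1), bulk bounded in the shell by the
  three-term density (`exists_bound_multBulk_le`) and `= 0` beyond `B`, the energies at times `0`
  and `τ` handled exactly as in §13.1 (coercivity on the collar up to `70M sin θ Φ²`, first Hardy
  inequality, boundedness of the degenerate `T`-energy);
* `Kerr.collar_timeIntegral_sq_le_of_transitionILED₃` (**Cor. 13.2.1, the zeroth-order term**):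
  `∫₀^τ ∫₀^{2π}∫₀^π∫_M^A sin θ Φ² ≤ C` — the one-dimensional Hardy inequality
  `Kerr.intervalIntegral_sq_le_four_mul` (Prop. 4.4.1) applied along each `r`-line to `η(r)Φ` with a
  smooth cut-off `η = 1` on `[M, A]`, `η = 0` beyond `B`, whose error lives in the transition shell;
* `Kerr.integrableOn_nearHorizonShell_of_transitionILED₃`: hence
  `τ ↦ ∫₀^{2π}∫₀^π∫_M^A sin θ (Φ² + (r − M)²(∂_ρΦ)²)` (continuous, non-negative, with bounded
  integrals `∫₀^τ`) is integrable on `(0, ∞)`;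
* `Aretakis2012_integratedDecay_of_transitionILED₃`, and with
  `Aretakis2012_uniformBoundedness_of_transitionILED₃`, `Aretakis2012_pointwiseDecay_holds_of`:
  **all three named facts of the decomposition (Thms. 2 and 5 of the source in shell form) now rest
  on the single three-term thin-shell integrated decay statement for the class** — the dispersive
  estimate of §§9–12 of the source (Thm. 1 / Prop. 12.5.1) restricted to a shell
  `[A, B] ⊂ (M, 23M/21]`, away from the horizon and from the effective photon sphere `r = (1 + √2)M`.

Everything is proved; no named facts (D-0026).

## References

* S. Aretakis, *Decay of axisymmetric solutions of the wave equation on extreme Kerr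
  backgrounds*, J. Funct. Anal. 263 (2012) 2770–2831 (arXiv:1110.2006): §3 (Thms. 1, 2, 5), §4.4
  (Prop. 4.4.1), §7.2 (Prop. 7.2.1), §12.5 (Prop. 12.5.1), §13.1–13.2 (proof of Thm. 2,
  Cor. 13.2.1). [Aretakis2012]
-/

noncomputable section

open Real Set Filter MeasureTheory intervalIntegral
open scoped Topology ContDiff Manifold

namespace Literature.Barriers.FinalStateConjecture.Kerr

open Literature.Geometry.Lorentzian Literature.Geometry.Lorentzian.Kerr.StarCoord

section Collar

variable [Kerr.Facts] [Kerr.SliceFacts] {M r₀ : ℝ} {U₀ : Set (Kerr.region M r₀)} {Φ : E4 → ℝ}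

/-- **Aretakis 2012, Thm. 2 — the near-horizon spacetime bound for the degenerate transversal
derivative, for the class, from the three-term integrated decay in a transition shell.** Let `Φ` be
a globally smooth, everywhere axisymmetric member of Aretakis's class (`□_{g_{M,M}}Φ = 0` on an open
`U₀ ⊇ {r ≥ M, t* ≥ 0}`, data vanishing on `{t* = 0, ‖x⃗‖ > ρ}`), `M < A < B`, `A ≤ 23M/21`, and
suppose `∫₀^τ ∫₀^{2π}∫₀^π∫_A^B sin θ (Φ² + (TΦ)² + (∂_ρΦ)²)(p(t, r, θ, φ)) dt ≤ I` for all `τ ≥ 0`.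
Then there is `C` with `∫₀^τ ∫₀^{2π}∫₀^π∫_M^A sin θ (r − M)²(∂_ρΦ)²(p(t, r, θ, φ)) dt ≤ C` for all
`τ ≥ 0` (printed: `∫_{𝒜}(r − M)(Yψ)² ≤ C∫_{Σ₀}J^N_μ[ψ]n^μ`, `𝒜 = 𝓡(0, τ) ∩ {M ≤ r ≤ 23M/21}`; here
with the weaker weight `(r − M)² ≤ (r − M)(r + M)`). Proof: the energy identity
`Kerr.mult_identity_of_class` for the cut-off current of §13.1 (profiles `χN^Y`,
`χN^T + (1 − χ)`, `−χ/2 + ½χ'N^Y`) on `[0, τ] × [M, r₂]`; the horizon flux is `≥ 0`; on the collar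
`−bulk ≥ ¼ sin θ (r − M)(r + M)(∂_rG)²` (Prop. 7.2.1, `neg_multBulk_nCurrent_ge`), in the shell
`bulk ≤ K sin θ ((∂_{t*}G)² + (∂_rG)² + G²)` (`exists_bound_multBulk_le`), beyond `B` it vanishes;
the energy at time `τ` is bounded above on the collar by `70M sin θ Φ²` minus a non-negative
transversal term (coercivity, `nEnergy_collar_ge`), in the shell by the degenerate `T`-energy and
`Φ²`, and is `≤ 0` beyond `B`; the zeroth-order terms by the first Hardy inequality
(`shellIntegral_sq_le_initialEnergy`), the `T`-energy by its initial value; Fubini in `φ₀`.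
[cite: Aretakis2012, §13.1–13.2 (proof of Thm. 2) and §7.2 (Prop. 7.2.1)] -/
theorem collar_timeIntegral_degRhoDeriv_sq_le_of_transitionILED₃ (hM : 0 < M)
    (hr₀ : r₀ ∈ Set.Ioo 0 M) (hU₀ : IsOpen U₀)
    (hKU : {x : Kerr.region M r₀ | Kerr.rPlus M M ≤ Kerr.radius M (x : E4) ∧ 0 ≤ (x : E4) 0} ⊆ U₀)
    (hΦ : ContDiff ℝ ∞ Φ)
    (haxi : ∀ (β : ℝ) (z : E4), Φ (E4.axialRotation β z) = Φ z)
    (hsol : ∀ x ∈ U₀, (Kerr.smoothMetric M M r₀).toPseudoRiemannianMetric.dalembertian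
      (fun y : Kerr.region M r₀ ↦ Φ y) x = 0)
    {ρ : ℝ} (hloc : ∀ x ∈ U₀, (x : E4) 0 = 0 → ρ < E4.spatialNorm (x : E4) →
      Φ x = 0 ∧ fderiv ℝ Φ x = 0)
    {A B I : ℝ} (hMA : M < A) (hAB : A < B) (hA23 : A ≤ 23 / 21 * M)
    (hI : ∀ τ : ℝ, 0 ≤ τ → (∫ t in (0 : ℝ)..τ, shellIntegral A B (fun r θ φ ↦ sin θ *
        (Φ (shellPoint M t r θ φ) ^ 2 +
          (fderiv ℝ Φ (shellPoint M t r θ φ) (E4.basisVector 0)) ^ 2 +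
          (fderiv ℝ Φ (shellPoint M t r θ φ) (E4.spaceEmbed (sphRadial θ φ))) ^ 2))) ≤ I) :
    ∃ C : ℝ, ∀ τ : ℝ, 0 ≤ τ →
      (∫ t in (0 : ℝ)..τ, shellIntegral M A (fun r θ φ ↦ sin θ * ((r - M) ^ 2 *
        (fderiv ℝ Φ (shellPoint M t r θ φ) (E4.spaceEmbed (sphRadial θ φ))) ^ 2))) ≤ C := by
  obtain ⟨hr₀pos, hr₀M⟩ := hr₀
  have hπ := pi_pos
  have hΦ' : ∀ x ∈ U₀, ContDiffAt ℝ ∞ Φ x := fun x _ ↦ hΦ.contDiffAt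
  have haxi' : ∀ (β : ℝ) (z : E4), 0 < Kerr.radius M z → Φ (E4.axialRotation β z) = Φ z :=
    fun β z _ ↦ haxi β z
  have hdiff : Differentiable ℝ Φ := hΦ.differentiable (by simp)
  have hMA' : M ≤ A := hMA.le
  have hMB : M ≤ B := hMA'.trans hAB.le
  /- ## the pull-back `G = Φ ∘ κ` and the dictionary at box points -/
  have hGs : ContDiff ℝ ∞ (Kerr.starPull M Φ) := hΦ.comp (Kerr.contDiff_starChart M)
  have dict0 : ∀ t r θ φ, Kerr.starPull M Φ (boxPoint φ t r θ) = Φ (shellPoint M t r θ φ) := by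
    intro t r θ φ; rw [Kerr.starPull_apply, starChart_boxPoint]
  have dictT : ∀ t r θ φ, pd 0 (Kerr.starPull M Φ) (boxPoint φ t r θ) =
      fderiv ℝ Φ (shellPoint M t r θ φ) (E4.basisVector 0) := by
    intro t r θ φ; rw [pd_starPull_boxPoint (hdiff _) 0, Kerr.starFrame_zero]
  have dictR : ∀ t r θ φ, pd 1 (Kerr.starPull M Φ) (boxPoint φ t r θ) =
      fderiv ℝ Φ (shellPoint M t r θ φ) (E4.spaceEmbed (sphRadial θ φ)) := by
    intro t r θ φ; rw [pd_starPull_boxPoint (hdiff _) 1, Kerr.starFrame_one]; rfl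
  /- ## the cut-off and the profiles -/
  obtain ⟨χ, hχ, hχ1, hχ0, hχnn⟩ := exists_smooth_plateau_nonneg (A' := A + (B - A) / 3)
    (B' := B - (B - A) / 3) (by linarith)
  have hχ' : ContDiff ℝ ∞ (deriv χ) := (contDiff_infty_iff_deriv.mp hχ).2
  obtain ⟨f, hfdef⟩ : ∃ f : ℝ → ℝ, f = fun r ↦ χ r * nProfileR M r := ⟨_, rfl⟩
  obtain ⟨h, hhdef⟩ : ∃ h : ℝ → ℝ, h = fun r ↦ χ r * nProfileT M r + (1 - χ r) := ⟨_, rfl⟩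
  obtain ⟨w, hwdef⟩ : ∃ w : ℝ → ℝ, w = fun r ↦ χ r * nProfileW r +
      1 / 2 * deriv χ r * nProfileR M r := ⟨_, rfl⟩
  have hf : ContDiff ℝ ∞ f := by rw [hfdef]; exact hχ.mul (contDiff_nProfileR M)
  have hh : ContDiff ℝ ∞ h := by
    rw [hhdef]; exact (hχ.mul (contDiff_nProfileT M)).add (contDiff_const.sub hχ)
  have hw : ContDiff ℝ ∞ w := by
    rw [hwdef]
    exact (hχ.mul contDiff_nProfileW).add ((contDiff_const.mul hχ').mul (contDiff_nProfileR M))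
  -- the derivative of the cut-off vanishes near the collar and near the tail
  have hχd1 : ∀ r, r ≤ A → deriv χ =ᶠ[𝓝 r] fun _ ↦ 0 := fun r hr ↦ by
    have h1 : χ =ᶠ[𝓝 r] fun _ ↦ (1 : ℝ) := by
      filter_upwards [Iio_mem_nhds (show r < A + (B - A) / 3 by linarith)] with s hs
      exact hχ1 s (le_of_lt hs)
    filter_upwards [h1.deriv] with s hs
    rw [hs, deriv_const]
  have hχd0 : ∀ r, B ≤ r → deriv χ =ᶠ[𝓝 r] fun _ ↦ 0 := fun r hr ↦ by
    have h0 : χ =ᶠ[𝓝 r] fun _ ↦ (0 : ℝ) := by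
      filter_upwards [Ioi_mem_nhds (show B - (B - A) / 3 < r by linarith)] with s hs
      exact hχ0 s (le_of_lt hs)
    filter_upwards [h0.deriv] with s hs
    rw [hs, deriv_const]
  -- the sign of the angular coefficient `½f' − w = −χ/2 ≤ 0`
  have hsign : ∀ r, 1 / 2 * deriv f r - w r ≤ 0 := by
    intro r
    have hχdiff : DifferentiableAt ℝ χ r := (hχ.differentiable (by simp)).differentiableAt
    have hnR : DifferentiableAt ℝ (nProfileR M) r :=
      ((contDiff_nProfileR M).differentiable (by simp)).differentiableAt
    have hdf : deriv f r = deriv χ r * nProfileR M r + χ r * deriv (nProfileR M) r := by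
      rw [hfdef]; exact deriv_mul hχdiff hnR
    rw [hdf, deriv_nProfileR, hwdef]
    simp only [nProfileW]
    linarith [hχnn r]
  have hχ1ev : ∀ r, r ≤ A → ∀ᶠ s in 𝓝 r, χ s = 1 := fun r hr ↦ by
    filter_upwards [Iio_mem_nhds (show r < A + (B - A) / 3 by linarith)] with s hs
    exact hχ1 s (le_of_lt hs)
  have hχ0ev : ∀ r, B ≤ r → ∀ᶠ s in 𝓝 r, χ s = 0 := fun r hr ↦ by
    filter_upwards [Ioi_mem_nhds (show B - (B - A) / 3 < r by linarith)] with s hs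
    exact hχ0 s (le_of_lt hs)
  have hfN : ∀ r, r ≤ A → f =ᶠ[𝓝 r] nProfileR M := fun r hr ↦ by
    filter_upwards [hχ1ev r hr] with s hs; rw [hfdef]; simp [hs]
  have hhN : ∀ r, r ≤ A → h =ᶠ[𝓝 r] nProfileT M := fun r hr ↦ by
    filter_upwards [hχ1ev r hr] with s hs; rw [hhdef]; simp [hs]
  have hwN : ∀ r, r ≤ A → w =ᶠ[𝓝 r] nProfileW := fun r hr ↦ by
    filter_upwards [hχ1ev r hr, hχd1 r hr] with s hs hs'; rw [hwdef]; simp [hs, hs']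
  have hfT : ∀ r, B ≤ r → f =ᶠ[𝓝 r] fun _ ↦ 0 := fun r hr ↦ by
    filter_upwards [hχ0ev r hr] with s hs; rw [hfdef]; simp [hs]
  have hhT : ∀ r, B ≤ r → h =ᶠ[𝓝 r] fun _ ↦ 1 := fun r hr ↦ by
    filter_upwards [hχ0ev r hr] with s hs; rw [hhdef]; simp [hs]
  have hwT : ∀ r, B ≤ r → w =ᶠ[𝓝 r] fun _ ↦ 0 := fun r hr ↦ by
    filter_upwards [hχ0ev r hr, hχd0 r hr] with s hs hs'; rw [hwdef]; simp [hs, hs']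
  /- ## continuity of the densities of the cut-off current along the boxes -/
  obtain ⟨hEs, -, -, hBc⟩ := contDiffOn_mult (M := M) (a := M) isOpen_univ hGs.contDiffOn hf hh hw
  have cE : Continuous (multDensity M M f h w (Kerr.starPull M Φ)) :=
    (contDiffOn_univ.mp hEs).continuous
  have cB : Continuous (multBulk M M f h w (Kerr.starPull M Φ)) := continuousOn_univ.mp hBc
  have cE4 : Continuous fun q : ℝ × ℝ × ℝ × ℝ ↦
      multDensity M M f h w (Kerr.starPull M Φ) (boxPoint q.2.2.2 q.1 q.2.1 q.2.2.1) := by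
    have hc := cE.comp continuous_boxPoint₄; rw [Function.comp_def] at hc; exact hc
  have cB4 : Continuous fun q : ℝ × ℝ × ℝ × ℝ ↦
      multBulk M M f h w (Kerr.starPull M Φ) (boxPoint q.2.2.2 q.1 q.2.1 q.2.2.1) := by
    have hc := cB.comp continuous_boxPoint₄; rw [Function.comp_def] at hc; exact hc
  have cE3 : ∀ φ₀, Continuous fun p : ℝ × ℝ × ℝ ↦
      multDensity M M f h w (Kerr.starPull M Φ) (boxPoint φ₀ p.1 p.2.1 p.2.2) := fun φ₀ ↦ by
    have hc := cE.comp (continuous_boxPoint φ₀); rw [Function.comp_def] at hc; exact hc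
  have cB3 : ∀ φ₀, Continuous fun p : ℝ × ℝ × ℝ ↦
      multBulk M M f h w (Kerr.starPull M Φ) (boxPoint φ₀ p.1 p.2.1 p.2.2) := fun φ₀ ↦ by
    have hc := cB.comp (continuous_boxPoint φ₀); rw [Function.comp_def] at hc; exact hc
  -- the energy-type density `J = sin θ ((∂_{t*}G)² + (∂_rG)² + (∂_θG)² + G²)` and its pieces
  have cpd : ∀ i, Continuous fun q : ℝ × ℝ × ℝ × ℝ ↦
      pd i (Kerr.starPull M Φ) (boxPoint q.2.2.2 q.1 q.2.1 q.2.2.1) := fun i ↦ by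
    have hc := ((hGs.continuous_fderiv (by simp)).clm_apply continuous_const :
      Continuous fun q : E4 ↦ fderiv ℝ (Kerr.starPull M Φ) q (E4.basisVector i)).comp
      continuous_boxPoint₄
    rw [Function.comp_def] at hc; exact hc
  have cG4 : Continuous fun q : ℝ × ℝ × ℝ × ℝ ↦
      Kerr.starPull M Φ (boxPoint q.2.2.2 q.1 q.2.1 q.2.2.1) := by
    have hc := hGs.continuous.comp continuous_boxPoint₄; rw [Function.comp_def] at hc; exact hc
  have csin4 : Continuous fun q : ℝ × ℝ × ℝ × ℝ ↦ sin q.2.2.1 := by fun_prop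
  have crM4 : Continuous fun q : ℝ × ℝ × ℝ × ℝ ↦ (q.2.1 - M) ^ 2 := by fun_prop
  obtain ⟨J, hJ⟩ : ∃ J : ℝ → ℝ → ℝ → ℝ → ℝ, J = fun t r θ φ ↦ sin θ *
      (pd 0 (Kerr.starPull M Φ) (boxPoint φ t r θ) ^ 2 + pd 1 (Kerr.starPull M Φ) (boxPoint φ t r θ) ^ 2 +
        pd 2 (Kerr.starPull M Φ) (boxPoint φ t r θ) ^ 2 + Kerr.starPull M Φ (boxPoint φ t r θ) ^ 2) :=
    ⟨_, rfl⟩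
  have cJ4 : Continuous fun q : ℝ × ℝ × ℝ × ℝ ↦ J q.1 q.2.1 q.2.2.1 q.2.2.2 := by
    rw [hJ]
    exact csin4.mul (((((cpd 0).pow 2).add ((cpd 1).pow 2)).add ((cpd 2).pow 2)).add (cG4.pow 2))
  -- the same without the angular derivative (for the bulk in the transition shell)
  obtain ⟨J₃, hJ₃⟩ : ∃ J₃ : ℝ → ℝ → ℝ → ℝ → ℝ, J₃ = fun t r θ φ ↦ sin θ *
      (pd 0 (Kerr.starPull M Φ) (boxPoint φ t r θ) ^ 2 + pd 1 (Kerr.starPull M Φ) (boxPoint φ t r θ) ^ 2 +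
        Kerr.starPull M Φ (boxPoint φ t r θ) ^ 2) := ⟨_, rfl⟩
  have cJ₃4 : Continuous fun q : ℝ × ℝ × ℝ × ℝ ↦ J₃ q.1 q.2.1 q.2.2.1 q.2.2.2 := by
    rw [hJ₃]
    exact csin4.mul ((((cpd 0).pow 2).add ((cpd 1).pow 2)).add (cG4.pow 2))
  -- the transversal, the degenerate transversal and the zeroth-order densities on the collar
  obtain ⟨P₁, hP₁⟩ : ∃ P₁ : ℝ → ℝ → ℝ → ℝ → ℝ, P₁ = fun t r θ φ ↦ sin θ *
      pd 1 (Kerr.starPull M Φ) (boxPoint φ t r θ) ^ 2 := ⟨_, rfl⟩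
  have cP₁ : Continuous fun q : ℝ × ℝ × ℝ × ℝ ↦ P₁ q.1 q.2.1 q.2.2.1 q.2.2.2 := by
    rw [hP₁]; exact csin4.mul ((cpd 1).pow 2)
  obtain ⟨W, hW⟩ : ∃ W : ℝ → ℝ → ℝ → ℝ → ℝ, W = fun t r θ φ ↦ sin θ * ((r - M) ^ 2 *
      pd 1 (Kerr.starPull M Φ) (boxPoint φ t r θ) ^ 2) := ⟨_, rfl⟩
  have cW : Continuous fun q : ℝ × ℝ × ℝ × ℝ ↦ W q.1 q.2.1 q.2.2.1 q.2.2.2 := by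
    rw [hW]; exact csin4.mul (crM4.mul ((cpd 1).pow 2))
  obtain ⟨Z₁, hZ₁⟩ : ∃ Z₁ : ℝ → ℝ → ℝ → ℝ → ℝ, Z₁ = fun t r θ φ ↦ sin θ *
      Kerr.starPull M Φ (boxPoint φ t r θ) ^ 2 := ⟨_, rfl⟩
  have cZ₁ : Continuous fun q : ℝ × ℝ × ℝ × ℝ ↦ Z₁ q.1 q.2.1 q.2.2.1 q.2.2.2 := by
    rw [hZ₁]; exact csin4.mul (cG4.pow 2)
  /- ## the constants -/
  obtain ⟨Kb, hKb0, hKb⟩ := exists_bound_multBulk_le M M A B hf hh hw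
  obtain ⟨Ke, hKe0, hKe⟩ := exists_bound_multDensity M M A B hf hh hw
  obtain ⟨E₀, hE₀⟩ : ∃ E₀ : ℝ, E₀ = shellIntegral M (max ρ (2 * M) + 2)
      (fun r θ φ ↦ degTEnergyDensity M Φ 0 r θ φ) := ⟨_, rfl⟩
  have hE₀0 : 0 ≤ E₀ := hE₀ ▸ initialDegTEnergyShell_nonneg hM hΦ ρ
  obtain ⟨m₀, hm₀⟩ : ∃ m₀ : ℝ, m₀ = min (min ((A - M) ^ 2) (A ^ 2)) 1 := ⟨_, rfl⟩
  have hm₀pos : 0 < m₀ := by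
    rw [hm₀]; exact lt_min (lt_min (by nlinarith) (by nlinarith)) zero_lt_one
  -- the initial `N`-energy per unit `φ*` and its integral
  obtain ⟨Einit, hEinit⟩ : ∃ Einit : ℝ → ℝ, Einit = fun φ₀ ↦ ∫ θ in (0 : ℝ)..π,
      ∫ r in M..(max ρ (2 * M) + 2), multDensity M M f h w (Kerr.starPull M Φ) (boxPoint φ₀ 0 r θ) :=
    ⟨_, rfl⟩
  have cEinit : Continuous Einit := by
    rw [hEinit]
    have hc := continuous_boxIntegral_param₂
      (J := fun t r θ φ ↦ multDensity M M f h w (Kerr.starPull M Φ) (boxPoint φ t r θ)) cE4 M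
      (max ρ (2 * M) + 2)
    have hc2 : Continuous fun φ₀ : ℝ ↦ ((0, φ₀) : ℝ × ℝ) := by fun_prop
    have hc3 := hc.comp hc2
    rw [Function.comp_def] at hc3
    exact hc3
  obtain ⟨Cinit, hCinit⟩ : ∃ Cinit : ℝ, Cinit = ∫ φ₀ in (0 : ℝ)..2 * π, Einit φ₀ := ⟨_, rfl⟩
  -- the final constant
  refine ⟨4 * (|Cinit| + Kb * |I| + 70 * M * (8 * E₀) + Ke * (2 / m₀ * E₀ + 8 * E₀)),
    fun τ hτ ↦ ?_⟩
  /- ## the outer radius, beyond the support of the wave on `[0, τ]` -/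
  obtain ⟨r₂, hr₂⟩ : ∃ r₂ : ℝ, r₂ = max B (max ρ (2 * M) + τ + 2) := ⟨_, rfl⟩
  have hBr₂ : B ≤ r₂ := hr₂ ▸ le_max_left _ _
  have hr₂' : max ρ (2 * M) + τ + 2 ≤ r₂ := hr₂ ▸ le_max_right _ _
  have hfar₂ : max ρ (2 * M) + 1 + τ < r₂ := by linarith
  have hR₀r₂ : max ρ (2 * M) + 2 ≤ r₂ := by linarith
  have hMr₂ : M ≤ r₂ := hMB.trans hBr₂
  have hMR₀ : M ≤ max ρ (2 * M) + 2 := by have := le_max_right ρ (2 * M); linarith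
  /- ## the per-`φ₀` estimate -/
  have key : ∀ φ₀ : ℝ,
      1 / 4 * (∫ t in (0 : ℝ)..τ, ∫ θ in (0 : ℝ)..π, ∫ r in M..A, W t r θ φ₀) ≤
        -Einit φ₀ + Kb * (∫ t in (0 : ℝ)..τ, ∫ θ in (0 : ℝ)..π, ∫ r in A..B, J₃ t r θ φ₀) +
          70 * M * (∫ θ in (0 : ℝ)..π, ∫ r in M..A, Z₁ τ r θ φ₀) +
          Ke * (∫ θ in (0 : ℝ)..π, ∫ r in A..B, J τ r θ φ₀) := by
    intro φ₀
    -- (I) the energy identity and the sign of the horizon flux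
    have hid := mult_identity_of_class hM ⟨hr₀pos, hr₀M⟩ hU₀ hKU hΦ' haxi' hsol hloc hf hh hw
      (t₁ := 0) (t₂ := τ) (T := τ) (r₂ := r₂) (φ₀ := φ₀) le_rfl hτ le_rfl hfar₂
    have hF : 0 ≤ ∫ t in (0 : ℝ)..τ, ∫ θ in (0 : ℝ)..π,
        multFluxR M M f h w (Kerr.starPull M Φ) (boxPoint φ₀ t M θ) := by
      refine intervalIntegral.integral_nonneg hτ fun t _ ↦
        intervalIntegral.integral_nonneg hπ.le fun θ hθ ↦ ?_
      rw [multFluxR_congr_nhds (f₂ := nProfileR M) (h₂ := nProfileT M) (w₂ := nProfileW)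
        (by rw [boxPoint_apply_one]; exact (hfN M hMA').eq_of_nhds)
        (by rw [boxPoint_apply_one]; exact (hhN M hMA').eq_of_nhds)
        (by rw [boxPoint_apply_one]; exact hwN M hMA')]
      exact multFluxR_nCurrent_horizon_nonneg hM.le _ (boxPoint_apply_one _ _ _ _)
        (by rw [boxPoint_apply_two]; exact hθ)
    -- (II) the bulk: coercive on the collar, zero beyond `B`, bounded in the shell
    have hIb : ∀ t ∈ Icc 0 τ, (∫ θ in (0 : ℝ)..π, ∫ r in M..r₂,
        multBulk M M f h w (Kerr.starPull M Φ) (boxPoint φ₀ t r θ)) ≤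
        -(1 / 4) * (∫ θ in (0 : ℝ)..π, ∫ r in M..A, W t r θ φ₀) +
          Kb * ∫ θ in (0 : ℝ)..π, ∫ r in A..B, J₃ t r θ φ₀ := by
      intro t _
      have hc := continuous_uncurry_of_param
        (g := fun t r θ ↦ multBulk M M f h w (Kerr.starPull M Φ) (boxPoint φ₀ t r θ)) (cB3 φ₀) t
      rw [boxIntegral_split (b := A) hc, boxIntegral_split (a := A) (b := B) (c := r₂) hc]
      have h1 : (∫ θ in (0 : ℝ)..π, ∫ r in M..A,
          multBulk M M f h w (Kerr.starPull M Φ) (boxPoint φ₀ t r θ)) ≤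
          ∫ θ in (0 : ℝ)..π, ∫ r in M..A, -(1 / 4) * W t r θ φ₀ := by
        have hcW : Continuous (Function.uncurry fun r θ ↦ -(1 / 4) * W t r θ φ₀) := by
          have hc1 : Continuous fun x : ℝ × ℝ ↦ ((t, x.1, x.2, φ₀) : ℝ × ℝ × ℝ × ℝ) := by fun_prop
          have hc2 := cW.comp hc1
          rw [Function.comp_def] at hc2
          exact continuous_const.mul hc2
        refine boxIntegral_mono_on hMA' hc hcW fun r hr θ hθ ↦ ?_
        rw [multBulk_congr_nhds (f₂ := nProfileR M) (h₂ := nProfileT M) (w₂ := nProfileW)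
          (by rw [boxPoint_apply_one]; exact hfN r hr.2)
          (by rw [boxPoint_apply_one]; exact hhN r hr.2)
          (by rw [boxPoint_apply_one]; exact hwN r hr.2)]
        have hq := neg_multBulk_nCurrent_ge hM (Kerr.starPull M Φ) (q := boxPoint φ₀ t r θ)
          (by rw [boxPoint_apply_one]; exact hr.1) (by rw [boxPoint_apply_one]; exact hr.2.trans hA23)
          (by rw [boxPoint_apply_two]; exact hθ)
        simp only [boxPoint_apply_one, boxPoint_apply_two] at hq
        have hWval : W t r θ φ₀ = sin θ * ((r - M) ^ 2 *
            pd 1 (Kerr.starPull M Φ) (boxPoint φ₀ t r θ) ^ 2) := by rw [hW]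
        rw [hWval]
        have hs : 0 ≤ sin θ := sin_nonneg_of_nonneg_of_le_pi hθ.1 hθ.2
        have hrM : 0 ≤ r - M := by linarith [hr.1]
        have hx : 0 ≤ pd 1 (Kerr.starPull M Φ) (boxPoint φ₀ t r θ) ^ 2 := sq_nonneg _
        have hy : 0 ≤ pd 0 (Kerr.starPull M Φ) (boxPoint φ₀ t r θ) ^ 2 := sq_nonneg _
        have hz : 0 ≤ pd 2 (Kerr.starPull M Φ) (boxPoint φ₀ t r θ) ^ 2 := sq_nonneg _
        have d1 : 0 ≤ sin θ * pd 1 (Kerr.starPull M Φ) (boxPoint φ₀ t r θ) ^ 2 * ((r - M) * M) :=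
          mul_nonneg (mul_nonneg hs hx) (mul_nonneg hrM hM.le)
        have d2 : 0 ≤ sin θ * pd 0 (Kerr.starPull M Φ) (boxPoint φ₀ t r θ) ^ 2 * M ^ 2 :=
          mul_nonneg (mul_nonneg hs hy) (sq_nonneg M)
        have d3 : 0 ≤ sin θ * pd 2 (Kerr.starPull M Φ) (boxPoint φ₀ t r θ) ^ 2 := mul_nonneg hs hz
        linarith only [hq, d1, d2, d3]
      have h2 : (∫ θ in (0 : ℝ)..π, ∫ r in A..B,
          multBulk M M f h w (Kerr.starPull M Φ) (boxPoint φ₀ t r θ)) ≤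
          ∫ θ in (0 : ℝ)..π, ∫ r in A..B, Kb * J₃ t r θ φ₀ := by
        have hcJ : Continuous (Function.uncurry fun r θ ↦ Kb * J₃ t r θ φ₀) := by
          have hc1 : Continuous fun x : ℝ × ℝ ↦ ((t, x.1, x.2, φ₀) : ℝ × ℝ × ℝ × ℝ) := by fun_prop
          have hc2 := cJ₃4.comp hc1
          rw [Function.comp_def] at hc2
          exact continuous_const.mul hc2
        refine boxIntegral_mono_on hAB.le hc hcJ fun r hr θ hθ ↦ ?_
        have hb := hKb (Kerr.starPull M Φ) (boxPoint φ₀ t r θ) (by rw [boxPoint_apply_one]; exact hr)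
          (by rw [boxPoint_apply_two]; exact hθ) (by rw [boxPoint_apply_one]; exact hsign r)
        rw [hJ₃]; simpa only [boxPoint_apply_two] using hb
      have h3 : (∫ θ in (0 : ℝ)..π, ∫ r in B..r₂,
          multBulk M M f h w (Kerr.starPull M Φ) (boxPoint φ₀ t r θ)) = 0 := by
        refine boxIntegral_eq_zero_of fun r hr θ _ ↦ ?_
        rw [uIcc_of_le hBr₂] at hr
        rw [multBulk_congr_nhds (f₂ := fun _ ↦ 0) (h₂ := fun _ ↦ 1) (w₂ := fun _ ↦ 0)
          (by rw [boxPoint_apply_one]; exact hfT r hr.1)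
          (by rw [boxPoint_apply_one]; exact hhT r hr.1)
          (by rw [boxPoint_apply_one]; exact hwT r hr.1)]
        exact multBulk_T M M _ _
      rw [boxIntegral_const_mul] at h1 h2
      linarith
    -- (III) integrate the bulk bound in time
    have hcWt : Continuous fun t ↦ ∫ θ in (0 : ℝ)..π, ∫ r in M..A, W t r θ φ₀ := by
      have hc1 : Continuous fun p : ℝ × ℝ × ℝ ↦ ((p.1, p.2.1, p.2.2, φ₀) : ℝ × ℝ × ℝ × ℝ) := by
        fun_prop
      have hc2 := cW.comp hc1
      rw [Function.comp_def] at hc2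
      exact continuous_boxIntegral_param (g := fun t r θ ↦ W t r θ φ₀) hc2 M A
    have hcJt : Continuous fun t ↦ ∫ θ in (0 : ℝ)..π, ∫ r in A..B, J₃ t r θ φ₀ := by
      have hc1 : Continuous fun p : ℝ × ℝ × ℝ ↦ ((p.1, p.2.1, p.2.2, φ₀) : ℝ × ℝ × ℝ × ℝ) := by
        fun_prop
      have hc2 := cJ₃4.comp hc1
      rw [Function.comp_def] at hc2
      exact continuous_boxIntegral_param (g := fun t r θ ↦ J₃ t r θ φ₀) hc2 A B
    have hIbt : (∫ t in (0 : ℝ)..τ, ∫ θ in (0 : ℝ)..π, ∫ r in M..r₂,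
        multBulk M M f h w (Kerr.starPull M Φ) (boxPoint φ₀ t r θ)) ≤
        -(1 / 4) * (∫ t in (0 : ℝ)..τ, ∫ θ in (0 : ℝ)..π, ∫ r in M..A, W t r θ φ₀) +
          Kb * ∫ t in (0 : ℝ)..τ, ∫ θ in (0 : ℝ)..π, ∫ r in A..B, J₃ t r θ φ₀ := by
      have hi1 : IntervalIntegrable (fun t ↦ -(1 / 4) * ∫ θ in (0 : ℝ)..π, ∫ r in M..A, W t r θ φ₀)
          volume 0 τ := (continuous_const.mul hcWt).intervalIntegrable _ _
      have hi2 : IntervalIntegrable (fun t ↦ Kb * ∫ θ in (0 : ℝ)..π, ∫ r in A..B, J₃ t r θ φ₀)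
          volume 0 τ := (continuous_const.mul hcJt).intervalIntegrable _ _
      have hmono : (∫ t in (0 : ℝ)..τ, ∫ θ in (0 : ℝ)..π, ∫ r in M..r₂,
          multBulk M M f h w (Kerr.starPull M Φ) (boxPoint φ₀ t r θ)) ≤
          ∫ t in (0 : ℝ)..τ, (-(1 / 4) * (∫ θ in (0 : ℝ)..π, ∫ r in M..A, W t r θ φ₀) +
            Kb * ∫ θ in (0 : ℝ)..π, ∫ r in A..B, J₃ t r θ φ₀) :=
        intervalIntegral.integral_mono_on hτ
          ((continuous_boxIntegral_param
            (g := fun t r θ ↦ multBulk M M f h w (Kerr.starPull M Φ) (boxPoint φ₀ t r θ)) (cB3 φ₀) M r₂).intervalIntegrable _ _)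
          (hi1.add hi2) fun t ht ↦ hIb t ht
      rw [intervalIntegral.integral_add hi1 hi2, intervalIntegral.integral_const_mul,
        intervalIntegral.integral_const_mul] at hmono
      exact hmono
    -- (IV) the initial energy: the density vanishes beyond `R₀` at `t* = 0`
    have hI0 : (∫ θ in (0 : ℝ)..π, ∫ r in M..r₂,
        multDensity M M f h w (Kerr.starPull M Φ) (boxPoint φ₀ 0 r θ)) = Einit φ₀ := by
      rw [hEinit]
      have hc := continuous_uncurry_of_param
        (g := fun t r θ ↦ multDensity M M f h w (Kerr.starPull M Φ) (boxPoint φ₀ t r θ)) (cE3 φ₀) 0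
      rw [boxIntegral_split (b := max ρ (2 * M) + 2) hc,
        boxIntegral_eq_zero_of (a := max ρ (2 * M) + 2) (b := r₂), add_zero]
      intro r hr θ _
      rw [uIcc_of_le hR₀r₂] at hr
      have hfar₀ : max ρ (2 * M) + 1 + 0 < r := by linarith [hr.1]
      obtain ⟨hΦ0, hdΦ0⟩ := fderiv_shellPoint_eq_zero_of_far hM ⟨hr₀pos, hr₀M⟩ hU₀ hKU hΦ' hsol
        hloc hfar₀ le_rfl le_rfl θ φ₀
      have hG0 : Kerr.starPull M Φ (boxPoint φ₀ 0 r θ) = 0 := by rw [dict0]; exact hΦ0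
      have hpd : ∀ i, pd i (Kerr.starPull M Φ) (boxPoint φ₀ 0 r θ) = 0 := fun i ↦ by
        rw [pd_starPull_boxPoint (hdiff _) i, hdΦ0]; rfl
      rw [multDensity_eq_quadratic]
      simp only [hG0, hpd, mul_zero, add_zero, zero_pow two_ne_zero]
    -- (V) the energy at time `τ`: collar, shell, tail
    have hcEτ := continuous_uncurry_of_param
      (g := fun t r θ ↦ multDensity M M f h w (Kerr.starPull M Φ) (boxPoint φ₀ t r θ)) (cE3 φ₀) τ
    have hcP : Continuous (Function.uncurry fun r θ ↦ P₁ τ r θ φ₀) := by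
      have hc1 : Continuous fun x : ℝ × ℝ ↦ ((τ, x.1, x.2, φ₀) : ℝ × ℝ × ℝ × ℝ) := by fun_prop
      have hc2 := cP₁.comp hc1; rw [Function.comp_def] at hc2; exact hc2
    have hP0 : 0 ≤ ∫ θ in (0 : ℝ)..π, ∫ r in M..A, P₁ τ r θ φ₀ := by
      refine boxIntegral_nonneg hMA' hcP fun r _ θ hθ ↦ ?_
      rw [hP₁]
      exact mul_nonneg (sin_nonneg_of_nonneg_of_le_pi hθ.1 hθ.2) (sq_nonneg _)
    have hV1 : (∫ θ in (0 : ℝ)..π, ∫ r in M..A,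
        multDensity M M f h w (Kerr.starPull M Φ) (boxPoint φ₀ τ r θ)) ≤
        -(M ^ 3 / 16) * (∫ θ in (0 : ℝ)..π, ∫ r in M..A, P₁ τ r θ φ₀) +
          70 * M * (∫ θ in (0 : ℝ)..π, ∫ r in M..A, Z₁ τ r θ φ₀) := by
      have hcZ : Continuous (Function.uncurry fun r θ ↦ Z₁ τ r θ φ₀) := by
        have hc1 : Continuous fun x : ℝ × ℝ ↦ ((τ, x.1, x.2, φ₀) : ℝ × ℝ × ℝ × ℝ) := by fun_prop
        have hc2 := cZ₁.comp hc1; rw [Function.comp_def] at hc2; exact hc2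
      have hcP' : Continuous (Function.uncurry fun r θ ↦ -(M ^ 3 / 16) * P₁ τ r θ φ₀) :=
        continuous_const.mul hcP
      have hcZ' : Continuous (Function.uncurry fun r θ ↦ 70 * M * Z₁ τ r θ φ₀) :=
        continuous_const.mul hcZ
      have hcomb : Continuous (Function.uncurry fun r θ ↦
          -(M ^ 3 / 16) * P₁ τ r θ φ₀ + 70 * M * Z₁ τ r θ φ₀) := hcP'.add hcZ'
      have hle := boxIntegral_mono_on hMA' hcEτ hcomb fun r hr θ hθ ↦ by
        have hq := nEnergy_collar_ge hM (Kerr.starPull M Φ) (q := boxPoint φ₀ τ r θ)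
          (by rw [boxPoint_apply_one]; exact hr.1) (by rw [boxPoint_apply_one]; exact hr.2.trans hA23)
          (by rw [boxPoint_apply_two]; exact hθ)
        rw [multDensity_congr (f₂ := nProfileR M) (h₂ := nProfileT M) (w₂ := nProfileW)
          (by rw [boxPoint_apply_one]; exact (hfN r hr.2).eq_of_nhds)
          (by rw [boxPoint_apply_one]; exact (hhN r hr.2).eq_of_nhds)
          (by rw [boxPoint_apply_one]; exact (hwN r hr.2).eq_of_nhds)]
        rw [hP₁, hZ₁]
        simp only [boxPoint_apply_two] at hq
        linarith
      rw [boxIntegral_add hcP' hcZ', boxIntegral_const_mul, boxIntegral_const_mul] at hle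
      exact hle
    have hV2 : (∫ θ in (0 : ℝ)..π, ∫ r in A..B,
        multDensity M M f h w (Kerr.starPull M Φ) (boxPoint φ₀ τ r θ)) ≤
        Ke * ∫ θ in (0 : ℝ)..π, ∫ r in A..B, J τ r θ φ₀ := by
      have hcJ : Continuous (Function.uncurry fun r θ ↦ Ke * J τ r θ φ₀) := by
        have hc1 : Continuous fun x : ℝ × ℝ ↦ ((τ, x.1, x.2, φ₀) : ℝ × ℝ × ℝ × ℝ) := by fun_prop
        have hc2 := cJ4.comp hc1
        rw [Function.comp_def] at hc2
        exact continuous_const.mul hc2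
      rw [← boxIntegral_const_mul]
      refine boxIntegral_mono_on hAB.le hcEτ hcJ fun r hr θ hθ ↦ (le_abs_self _).trans ?_
      have hb := hKe (Kerr.starPull M Φ) (boxPoint φ₀ τ r θ) (by rw [boxPoint_apply_one]; exact hr)
        (by rw [boxPoint_apply_two]; exact hθ)
      rw [hJ]; simpa only [boxPoint_apply_two] using hb
    have hV3 : (∫ θ in (0 : ℝ)..π, ∫ r in B..r₂,
        multDensity M M f h w (Kerr.starPull M Φ) (boxPoint φ₀ τ r θ)) ≤ 0 := by
      refine boxIntegral_nonpos hBr₂ hcEτ fun r hr θ hθ ↦ ?_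
      rw [multDensity_congr (f₂ := fun _ ↦ 0) (h₂ := fun _ ↦ 1) (w₂ := fun _ ↦ 0)
        (by rw [boxPoint_apply_one]; exact (hfT r hr.1).eq_of_nhds)
        (by rw [boxPoint_apply_one]; exact (hhT r hr.1).eq_of_nhds)
        (by rw [boxPoint_apply_one]; exact (hwT r hr.1).eq_of_nhds), multDensity_T]
      have h0 := tEnergy_extremal_nonneg hM.le (Kerr.starPull M Φ) (q := boxPoint φ₀ τ r θ)
        (by rw [boxPoint_apply_one]; linarith [hr.1]) (by rw [boxPoint_apply_two]; exact hθ)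
      linarith
    have hV : (∫ θ in (0 : ℝ)..π, ∫ r in M..r₂,
        multDensity M M f h w (Kerr.starPull M Φ) (boxPoint φ₀ τ r θ)) ≤
        70 * M * (∫ θ in (0 : ℝ)..π, ∫ r in M..A, Z₁ τ r θ φ₀) +
          Ke * ∫ θ in (0 : ℝ)..π, ∫ r in A..B, J τ r θ φ₀ := by
      rw [boxIntegral_split (b := A) hcEτ, boxIntegral_split (a := A) (b := B) (c := r₂) hcEτ]
      have hM3 : 0 ≤ M ^ 3 / 16 := by positivity
      have hMP : 0 ≤ M ^ 3 / 16 * ∫ θ in (0 : ℝ)..π, ∫ r in M..A, P₁ τ r θ φ₀ := mul_nonneg hM3 hP0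
      linarith only [hV1, hV2, hV3, hMP]
    -- (VI) combine
    rw [hI0] at hid
    linarith only [hid, hF, hIbt, hV]
  /- ## integrate over `φ₀ ∈ [0, 2π]` -/
  have h2π : (0 : ℝ) ≤ 2 * π := by positivity
  -- continuity in `φ₀` of the five terms
  have cZφ : Continuous fun φ₀ ↦ ∫ θ in (0 : ℝ)..π, ∫ r in M..A, Z₁ τ r θ φ₀ := by
    have hc := continuous_boxIntegral_param₂ (J := Z₁) cZ₁ M A
    have hc2 : Continuous fun φ₀ : ℝ ↦ ((τ, φ₀) : ℝ × ℝ) := by fun_prop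
    have hc3 := hc.comp hc2; rw [Function.comp_def] at hc3; exact hc3
  have cJ2 : Continuous fun p : ℝ × ℝ ↦ ∫ θ in (0 : ℝ)..π, ∫ r in A..B, J p.1 r θ p.2 :=
    continuous_boxIntegral_param₂ (J := J) cJ4 A B
  have cJφ : Continuous fun φ₀ ↦ ∫ θ in (0 : ℝ)..π, ∫ r in A..B, J τ r θ φ₀ := by
    have hc2 : Continuous fun φ₀ : ℝ ↦ ((τ, φ₀) : ℝ × ℝ) := by fun_prop
    have hc3 := cJ2.comp hc2; rw [Function.comp_def] at hc3; exact hc3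
  have cJ2₃ : Continuous fun p : ℝ × ℝ ↦ ∫ θ in (0 : ℝ)..π, ∫ r in A..B, J₃ p.1 r θ p.2 :=
    continuous_boxIntegral_param₂ (J := J₃) cJ₃4 A B
  have cJswap : Continuous (Function.uncurry fun φ₀ t ↦ ∫ θ in (0 : ℝ)..π, ∫ r in A..B, J₃ t r θ φ₀) := by
    have hc := cJ2₃.comp continuous_swap; rw [Function.comp_def] at hc; exact hc
  have cJtφ : Continuous fun φ₀ ↦ ∫ t in (0 : ℝ)..τ, ∫ θ in (0 : ℝ)..π, ∫ r in A..B, J₃ t r θ φ₀ :=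
    intervalIntegral.continuous_parametric_intervalIntegral_of_continuous' cJswap 0 τ
  have cW2 : Continuous fun p : ℝ × ℝ ↦ ∫ θ in (0 : ℝ)..π, ∫ r in M..A, W p.1 r θ p.2 :=
    continuous_boxIntegral_param₂ (J := W) cW M A
  have cWswap : Continuous (Function.uncurry fun φ₀ t ↦ ∫ θ in (0 : ℝ)..π, ∫ r in M..A, W t r θ φ₀) := by
    have hc := cW2.comp continuous_swap; rw [Function.comp_def] at hc; exact hc
  have cWtφ : Continuous fun φ₀ ↦ ∫ t in (0 : ℝ)..τ, ∫ θ in (0 : ℝ)..π, ∫ r in M..A, W t r θ φ₀ :=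
    intervalIntegral.continuous_parametric_intervalIntegral_of_continuous' cWswap 0 τ
  -- integrate the per-`φ₀` estimate
  have c1 : Continuous fun φ₀ ↦ -Einit φ₀ := cEinit.neg
  have cX : Continuous fun φ₀ ↦ Kb * ∫ t in (0 : ℝ)..τ, ∫ θ in (0 : ℝ)..π, ∫ r in A..B, J₃ t r θ φ₀ :=
    continuous_const.mul cJtφ
  have c3 : Continuous fun φ₀ ↦ 70 * M * ∫ θ in (0 : ℝ)..π, ∫ r in M..A, Z₁ τ r θ φ₀ :=
    continuous_const.mul cZφ
  have c4 : Continuous fun φ₀ ↦ Ke * ∫ θ in (0 : ℝ)..π, ∫ r in A..B, J τ r θ φ₀ :=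
    continuous_const.mul cJφ
  have c12 : Continuous fun φ₀ ↦ -Einit φ₀ +
      Kb * ∫ t in (0 : ℝ)..τ, ∫ θ in (0 : ℝ)..π, ∫ r in A..B, J₃ t r θ φ₀ := c1.add cX
  have c123 : Continuous fun φ₀ ↦ -Einit φ₀ +
      Kb * (∫ t in (0 : ℝ)..τ, ∫ θ in (0 : ℝ)..π, ∫ r in A..B, J₃ t r θ φ₀) +
      70 * M * ∫ θ in (0 : ℝ)..π, ∫ r in M..A, Z₁ τ r θ φ₀ := c12.add c3
  have c1234 : Continuous fun φ₀ ↦ -Einit φ₀ +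
      Kb * (∫ t in (0 : ℝ)..τ, ∫ θ in (0 : ℝ)..π, ∫ r in A..B, J₃ t r θ φ₀) +
      70 * M * (∫ θ in (0 : ℝ)..π, ∫ r in M..A, Z₁ τ r θ φ₀) +
      Ke * ∫ θ in (0 : ℝ)..π, ∫ r in A..B, J τ r θ φ₀ := c123.add c4
  have cL : Continuous fun φ₀ ↦
      1 / 4 * ∫ t in (0 : ℝ)..τ, ∫ θ in (0 : ℝ)..π, ∫ r in M..A, W t r θ φ₀ :=
    continuous_const.mul cWtφ
  have hint := intervalIntegral.integral_mono_on (μ := volume) h2π (cL.intervalIntegrable _ _)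
    (c1234.intervalIntegrable _ _) fun φ₀ _ ↦ key φ₀
  rw [intervalIntegral.integral_const_mul,
    intervalIntegral.integral_add (c123.intervalIntegrable _ _) (c4.intervalIntegrable _ _),
    intervalIntegral.integral_add (c12.intervalIntegrable _ _) (c3.intervalIntegrable _ _),
    intervalIntegral.integral_add (c1.intervalIntegrable _ _) (cX.intervalIntegrable _ _),
    intervalIntegral.integral_neg, intervalIntegral.integral_const_mul,
    intervalIntegral.integral_const_mul, intervalIntegral.integral_const_mul, ← hCinit] at hint
  -- Fubini for the time integrals and the hypothesis
  have hswap : (∫ φ₀ in (0 : ℝ)..2 * π, ∫ t in (0 : ℝ)..τ, ∫ θ in (0 : ℝ)..π, ∫ r in A..B, J₃ t r θ φ₀) =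
      ∫ t in (0 : ℝ)..τ, shellIntegral A B (fun r θ φ ↦ J₃ t r θ φ) := by
    rw [intervalIntegral_swap_of_continuous cJswap h2π hτ]
    rfl
  have hswapW : (∫ φ₀ in (0 : ℝ)..2 * π, ∫ t in (0 : ℝ)..τ, ∫ θ in (0 : ℝ)..π, ∫ r in M..A, W t r θ φ₀) =
      ∫ t in (0 : ℝ)..τ, shellIntegral M A (fun r θ φ ↦ W t r θ φ) := by
    rw [intervalIntegral_swap_of_continuous cWswap h2π hτ]
    rfl
  have hJΦ : (fun t ↦ shellIntegral A B (fun r θ φ ↦ J₃ t r θ φ)) = fun t ↦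
      shellIntegral A B (fun r θ φ ↦ sin θ *
        (Φ (shellPoint M t r θ φ) ^ 2 +
          (fderiv ℝ Φ (shellPoint M t r θ φ) (E4.basisVector 0)) ^ 2 +
          (fderiv ℝ Φ (shellPoint M t r θ φ) (E4.spaceEmbed (sphRadial θ φ))) ^ 2)) := by
    funext t
    congr 1
    funext r θ φ
    rw [hJ₃]
    simp only [dict0, dictT, dictR]
    ring
  have hWΦ : (fun t ↦ shellIntegral M A (fun r θ φ ↦ W t r θ φ)) = fun t ↦
      shellIntegral M A (fun r θ φ ↦ sin θ * ((r - M) ^ 2 *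
        (fderiv ℝ Φ (shellPoint M t r θ φ) (E4.spaceEmbed (sphRadial θ φ))) ^ 2)) := by
    funext t
    congr 1
    funext r θ φ
    rw [hW]
    simp only [dictR]
  have hIτ : (∫ t in (0 : ℝ)..τ, shellIntegral A B (fun r θ φ ↦ J₃ t r θ φ)) ≤ |I| := by
    rw [hJΦ]; exact (hI τ hτ).trans (le_abs_self I)
  -- the zeroth-order term on the collar: Hardy
  have hZ : (∫ φ₀ in (0 : ℝ)..2 * π, ∫ θ in (0 : ℝ)..π, ∫ r in M..A, Z₁ τ r θ φ₀) ≤ 8 * E₀ := by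
    have h8 := shellIntegral_sq_le_initialEnergy hM ⟨hr₀pos, hr₀M⟩ hU₀ hKU hΦ haxi hsol hloc hτ hMA'
    rw [← hE₀] at h8
    have heq : (∫ φ₀ in (0 : ℝ)..2 * π, ∫ θ in (0 : ℝ)..π, ∫ r in M..A, Z₁ τ r θ φ₀) =
        shellIntegral M A (fun r θ φ ↦ sin θ * Φ (shellPoint M τ r θ φ) ^ 2) := by
      rw [hZ₁]; simp only [dict0]; rfl
    rw [heq]; exact h8
  -- the transition shell at time `τ`: degenerate energy and Hardy
  have hJτ : (∫ φ₀ in (0 : ℝ)..2 * π, ∫ θ in (0 : ℝ)..π, ∫ r in A..B, J τ r θ φ₀) ≤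
      2 / m₀ * E₀ + 8 * E₀ := by
    have hΦ1 : ContDiff ℝ 1 Φ := hΦ.of_le (by exact_mod_cast le_top)
    -- pointwise: `J ≤ (2/m₀) e_T + sin θ Φ²`
    have hcJ3 : Continuous fun q : ℝ × ℝ × ℝ ↦ J τ q.1 q.2.1 q.2.2 := by
      have hc1 : Continuous fun x : ℝ × ℝ × ℝ ↦ ((τ, x.1, x.2.1, x.2.2) : ℝ × ℝ × ℝ × ℝ) := by fun_prop
      have hc2 := cJ4.comp hc1; rw [Function.comp_def] at hc2; exact hc2
    have hsq : Continuous fun q : ℝ × ℝ × ℝ ↦ sin q.2.1 * Φ (shellPoint M τ q.1 q.2.1 q.2.2) ^ 2 :=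
      (continuous_sin.comp (continuous_fst.comp continuous_snd)).mul
        ((hΦ.continuous.comp (continuous_shellPoint M τ)).pow 2)
    have hcomb : Continuous fun q : ℝ × ℝ × ℝ ↦ 2 / m₀ * degTEnergyDensity M Φ τ q.1 q.2.1 q.2.2 +
        sin q.2.1 * Φ (shellPoint M τ q.1 q.2.1 q.2.2) ^ 2 :=
      (continuous_const.mul (continuous_degTEnergyDensity₃ hΦ1 M τ)).add hsq
    have hle : shellIntegral A B (fun r θ φ ↦ J τ r θ φ) ≤
        shellIntegral A B (fun r θ φ ↦ 2 / m₀ * degTEnergyDensity M Φ τ r θ φ +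
          sin θ * Φ (shellPoint M τ r θ φ) ^ 2) := by
      refine shellIntegral_mono_on hAB.le hcJ3 hcomb fun r hr θ hθ φ _ ↦ ?_
      have hq := sin_mul_sq_le_tEnergy hM hMA (Kerr.starPull M Φ) (q := boxPoint φ τ r θ)
        (by rw [boxPoint_apply_one]; exact hr.1) (by rw [boxPoint_apply_two]; exact hθ)
      rw [← hm₀, boxPoint_apply_two, tEnergy_starPull_boxPoint (hdiff _)] at hq
      have hdiv : sin θ * (pd 0 (Kerr.starPull M Φ) (boxPoint φ τ r θ) ^ 2 +
          pd 1 (Kerr.starPull M Φ) (boxPoint φ τ r θ) ^ 2 + pd 2 (Kerr.starPull M Φ) (boxPoint φ τ r θ) ^ 2) ≤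
          2 / m₀ * degTEnergyDensity M Φ τ r θ φ := by
        rw [div_mul_eq_mul_div, le_div_iff₀ hm₀pos]; linarith
      rw [hJ]
      simp only [dict0]
      linarith
    rw [shellIntegral_add (continuous_const.mul (continuous_degTEnergyDensity₃ hΦ1 M τ)) hsq,
      shellIntegral_const_mul] at hle
    have h1 : shellIntegral A B (fun r θ φ ↦ degTEnergyDensity M Φ τ r θ φ) ≤ E₀ := by
      have hmono := shellIntegral_mono_interval (g := fun r θ φ ↦ degTEnergyDensity M Φ τ r θ φ)
        hMA' hAB.le le_rfl (continuous_degTEnergyDensity₃ hΦ1 M τ)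
        fun r hr θ hθ φ _ ↦ degTEnergyDensity_nonneg hM.le Φ τ (hM.le.trans hr.1) hθ φ
      have hb := degTEnergyShell_le_initial hM ⟨hr₀pos, hr₀M⟩ hU₀ hKU hΦ haxi hsol hloc hτ hMB
      rw [← hE₀] at hb
      exact hmono.trans hb
    have h2 : shellIntegral A B (fun r θ φ ↦ sin θ * Φ (shellPoint M τ r θ φ) ^ 2) ≤ 8 * E₀ := by
      have hmono := shellIntegral_mono_interval (g := fun r θ φ ↦ sin θ * Φ (shellPoint M τ r θ φ) ^ 2)
        hMA' hAB.le le_rfl hsq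
        fun r _ θ hθ φ _ ↦ mul_nonneg (sin_nonneg_of_nonneg_of_le_pi hθ.1 hθ.2) (sq_nonneg _)
      have hb := shellIntegral_sq_le_initialEnergy hM ⟨hr₀pos, hr₀M⟩ hU₀ hKU hΦ haxi hsol hloc hτ hMB
      rw [← hE₀] at hb
      exact hmono.trans hb
    have heq : (∫ φ₀ in (0 : ℝ)..2 * π, ∫ θ in (0 : ℝ)..π, ∫ r in A..B, J τ r θ φ₀) =
        shellIntegral A B (fun r θ φ ↦ J τ r θ φ) := rfl
    rw [heq]
    have hm2 : 0 ≤ 2 / m₀ := by positivity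
    linarith only [hle, mul_le_mul_of_nonneg_left h1 hm2, h2]
  -- the left-hand side is the time integral of the collar integral
  rw [hswapW, hWΦ, hswap] at hint
  -- assemble
  have hKbI : Kb * (∫ t in (0 : ℝ)..τ, shellIntegral A B (fun r θ φ ↦ J₃ t r θ φ)) ≤ Kb * |I| :=
    mul_le_mul_of_nonneg_left hIτ hKb0
  have hKeJ := mul_le_mul_of_nonneg_left hJτ hKe0
  have h70 : 70 * M * (∫ φ₀ in (0 : ℝ)..2 * π, ∫ θ in (0 : ℝ)..π, ∫ r in M..A, Z₁ τ r θ φ₀) ≤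
      70 * M * (8 * E₀) := mul_le_mul_of_nonneg_left hZ (by positivity)
  have hC := neg_le_abs Cinit
  linarith only [hint, hKbI, hKeJ, h70, hC]

end Collar

/-! ### The zeroth-order term: the first Hardy inequality with a cut-off (Cor. 13.2.1) -/

section ZerothOrder

/-- A continuous non-negative function with uniformly bounded integrals `∫₀^τ`, `τ ≥ 0`, is
integrable on `(0, ∞)` (monotone convergence along `τ = n → ∞`). [folklore] -/
theorem integrableOn_Ioi_of_intervalIntegral_le {G : ℝ → ℝ} (hG : Continuous G)
    (hG0 : ∀ t, 0 ≤ G t) {C : ℝ} (hC : ∀ τ : ℝ, 0 ≤ τ → (∫ t in (0 : ℝ)..τ, G t) ≤ C) :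
    IntegrableOn G (Ioi 0) := by
  refine integrableOn_Ioi_of_intervalIntegral_norm_bounded (μ := volume) (l := atTop)
    (b := fun n : ℕ ↦ (n : ℝ)) C 0 (fun n ↦ ?_) tendsto_natCast_atTop_atTop ?_
  · exact (hG.integrableOn_Icc (a := 0) (b := (n : ℝ))).mono_set Ioc_subset_Icc_self
  · filter_upwards with n
    have heq : (∫ x in (0 : ℝ)..n, ‖G x‖) = ∫ x in (0 : ℝ)..n, G x :=
      intervalIntegral.integral_congr fun x _ ↦ by
        rw [Real.norm_eq_abs, abs_of_nonneg (hG0 x)]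
    rw [heq]
    exact hC n (Nat.cast_nonneg n)

/-- **The zeroth-order term on the collar by the first Hardy inequality with a radial cut-off.**
For `Φ ∈ C¹(E4)`, `M ≤ A < B`, there is `c ≥ 0` such that on every leaf `{t* = t}`
`∫∫∫_M^A sin θ Φ² ≤ 4 ∫∫∫_M^A sin θ (r − M)²(∂_ρΦ)² + c ∫∫∫_A^B sin θ (Φ² + (TΦ)² + (∂_ρΦ)²)`
(`p = p(t, r, θ, φ)`). Proof: along each `r`-line apply the one-dimensional Hardy inequality
`Kerr.intervalIntegral_sq_le_four_mul` (Aretakis 2012, Prop. 4.4.1) on `[M, B]` to `η(r)Φ(p)`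
with a smooth cut-off `η = 1` on `(−∞, A]`, `η = 0` near `B`; on `[M, A]` this is `Φ` with
derivative `∂_ρΦ`, and on `[A, B]` the weight `(r − M)² ≤ (B − M)²` and `|η|, |η'| ≤ K` bound the
error by `Φ² + (∂_ρΦ)²`; then integrate against `sin θ dθ dφ` (the printed Cor. 13.2.1 controls
`∫ψ²` near `𝓗⁺` by the degenerate spacetime term and the energy away from `𝓗⁺`).
[cite: Aretakis2012, §4.4 (Prop. 4.4.1) and §13.2 (Cor. 13.2.1)] -/
theorem shellIntegral_sq_le_cutoffHardy {M A B : ℝ} (hMA : M ≤ A) (hAB : A < B) {Φ : E4 → ℝ}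
    (hΦ : ContDiff ℝ 1 Φ) :
    ∃ c : ℝ, 0 ≤ c ∧ ∀ t : ℝ,
      shellIntegral M A (fun r θ φ ↦ sin θ * Φ (shellPoint M t r θ φ) ^ 2) ≤
        4 * shellIntegral M A (fun r θ φ ↦ sin θ * ((r - M) ^ 2 *
          (fderiv ℝ Φ (shellPoint M t r θ φ) (E4.spaceEmbed (sphRadial θ φ))) ^ 2)) +
        c * shellIntegral A B (fun r θ φ ↦ sin θ *
          (Φ (shellPoint M t r θ φ) ^ 2 +
            (fderiv ℝ Φ (shellPoint M t r θ φ) (E4.basisVector 0)) ^ 2 +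
            (fderiv ℝ Φ (shellPoint M t r θ φ) (E4.spaceEmbed (sphRadial θ φ))) ^ 2)) := by
  have hMB : M ≤ B := hMA.trans hAB.le
  have hdiff : Differentiable ℝ Φ := hΦ.differentiable one_ne_zero
  -- the cut-off
  obtain ⟨η, hη, hη1, hη0, -⟩ := exists_smooth_plateau_nonneg (A' := A + (B - A) / 3)
    (B' := B - (B - A) / 3) (by linarith)
  have hη' : ContDiff ℝ ∞ (deriv η) := (contDiff_infty_iff_deriv.mp hη).2
  have hηd : ∀ r, HasDerivAt η (deriv η r) r := fun r ↦
    ((hη.differentiable (by simp)).differentiableAt).hasDerivAt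
  have hη1A : ∀ r, r ≤ A → η r = 1 := fun r hr ↦ hη1 r (by linarith)
  have hηB : η B = 0 := hη0 B (by linarith)
  have hηdA : ∀ r, r ≤ A → deriv η r = 0 := fun r hr ↦ by
    have h1 : η =ᶠ[𝓝 r] fun _ ↦ (1 : ℝ) := by
      filter_upwards [Iio_mem_nhds (show r < A + (B - A) / 3 by linarith)] with s hs
      exact hη1 s (le_of_lt hs)
    rw [h1.deriv_eq, deriv_const]
  obtain ⟨K0, hK0⟩ := isCompact_Icc.exists_bound_of_continuousOn
    (hη.continuous.continuousOn (s := Icc A B))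
  obtain ⟨Kd, hKd⟩ := isCompact_Icc.exists_bound_of_continuousOn
    (hη'.continuous.continuousOn (s := Icc A B))
  obtain ⟨c, hc⟩ : ∃ c : ℝ, c = 8 * (B - M) ^ 2 * (Kd ^ 2 + K0 ^ 2) := ⟨_, rfl⟩
  have hc0 : 0 ≤ c := by rw [hc]; positivity
  refine ⟨c, hc0, fun t ↦ ?_⟩
  -- names for `Φ` and its derivatives along the shell at time `t`
  obtain ⟨F, hF⟩ : ∃ F : ℝ → ℝ → ℝ → ℝ, F = fun r θ φ ↦ Φ (shellPoint M t r θ φ) := ⟨_, rfl⟩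
  obtain ⟨D, hD⟩ : ∃ D : ℝ → ℝ → ℝ → ℝ, D = fun r θ φ ↦
      fderiv ℝ Φ (shellPoint M t r θ φ) (E4.spaceEmbed (sphRadial θ φ)) := ⟨_, rfl⟩
  obtain ⟨T, hT⟩ : ∃ T : ℝ → ℝ → ℝ → ℝ, T = fun r θ φ ↦
      fderiv ℝ Φ (shellPoint M t r θ φ) (E4.basisVector 0) := ⟨_, rfl⟩
  have cF : Continuous fun q : ℝ × ℝ × ℝ ↦ F q.1 q.2.1 q.2.2 := by
    rw [hF]; exact hΦ.continuous.comp (continuous_shellPoint M t)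
  have cD : Continuous fun q : ℝ × ℝ × ℝ ↦ D q.1 q.2.1 q.2.2 := by
    rw [hD]
    exact ((hΦ.continuous_fderiv one_ne_zero).comp (continuous_shellPoint M t)).clm_apply
      (continuous_spaceEmbed_sphRadial.comp continuous_snd)
  have cT : Continuous fun q : ℝ × ℝ × ℝ ↦ T q.1 q.2.1 q.2.2 := by
    rw [hT]
    exact ((hΦ.continuous_fderiv one_ne_zero).comp (continuous_shellPoint M t)).clm_apply
      continuous_const
  /- ## the one-dimensional inequality along each `r`-line -/
  have h1D : ∀ θ φ : ℝ, (∫ r in M..A, F r θ φ ^ 2) ≤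
      4 * (∫ r in M..A, (r - M) ^ 2 * D r θ φ ^ 2) +
        c * ∫ r in A..B, (F r θ φ ^ 2 + T r θ φ ^ 2 + D r θ φ ^ 2) := by
    intro θ φ
    -- continuity in `r`
    have emb : Continuous fun r : ℝ ↦ ((r, θ, φ) : ℝ × ℝ × ℝ) := by fun_prop
    have cFr : Continuous fun r ↦ F r θ φ := by
      have h := cF.comp emb; rw [Function.comp_def] at h; exact h
    have cDr : Continuous fun r ↦ D r θ φ := by
      have h := cD.comp emb; rw [Function.comp_def] at h; exact h
    have cTr : Continuous fun r ↦ T r θ φ := by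
      have h := cT.comp emb; rw [Function.comp_def] at h; exact h
    -- the cut-off function `η Φ(p)` and its derivative
    have hFd : ∀ r, HasDerivAt (fun s ↦ F s θ φ) (D r θ φ) r := fun r ↦ by
      rw [hF, hD]; exact hasDerivAt_comp_shellPoint (hdiff _)
    have hg : ∀ r ∈ Icc M B, HasDerivAt (fun s ↦ η s * F s θ φ)
        (deriv η r * F r θ φ + η r * D r θ φ) r := fun r _ ↦ (hηd r).mul (hFd r)
    have cg' : Continuous fun r ↦ deriv η r * F r θ φ + η r * D r θ φ :=
      (hη'.continuous.mul cFr).add (hη.continuous.mul cDr)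
    have hgB : η B * F B θ φ = 0 := by rw [hηB, zero_mul]
    have hH := intervalIntegral_sq_le_four_mul (g := fun s ↦ η s * F s θ φ)
      (g' := fun r ↦ deriv η r * F r θ φ + η r * D r θ φ) hMB hg cg'.continuousOn hgB
    -- split both integrals at `A`
    have cg2 : Continuous fun s ↦ (η s * F s θ φ) ^ 2 := (hη.continuous.mul cFr).pow 2
    have cwg : Continuous fun r ↦ (r - M) ^ 2 * (deriv η r * F r θ φ + η r * D r θ φ) ^ 2 :=
      ((continuous_id.sub continuous_const).pow 2).mul (cg'.pow 2)
    rw [← intervalIntegral.integral_add_adjacent_intervals (cg2.intervalIntegrable M A)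
        (cg2.intervalIntegrable A B),
      ← intervalIntegral.integral_add_adjacent_intervals (cwg.intervalIntegrable M A)
        (cwg.intervalIntegrable A B)] at hH
    -- on the collar the cut-off is `1` with vanishing derivative
    have e1 : (∫ s in M..A, (η s * F s θ φ) ^ 2) = ∫ r in M..A, F r θ φ ^ 2 := by
      refine intervalIntegral.integral_congr fun r hr ↦ ?_
      rw [uIcc_of_le hMA] at hr
      simp only [hη1A r hr.2, one_mul]
    have e2 : (∫ r in M..A, (r - M) ^ 2 * (deriv η r * F r θ φ + η r * D r θ φ) ^ 2) =
        ∫ r in M..A, (r - M) ^ 2 * D r θ φ ^ 2 := by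
      refine intervalIntegral.integral_congr fun r hr ↦ ?_
      rw [uIcc_of_le hMA] at hr
      simp only [hη1A r hr.2, hηdA r hr.2, zero_mul, one_mul, zero_add]
    -- in the shell: non-negativity, and the error bounded by `Φ²` and `(∂_ρΦ)²`
    have e3 : 0 ≤ ∫ s in A..B, (η s * F s θ φ) ^ 2 :=
      intervalIntegral.integral_nonneg hAB.le fun r _ ↦ sq_nonneg _
    have e4 : (∫ r in A..B, (r - M) ^ 2 * (deriv η r * F r θ φ + η r * D r θ φ) ^ 2) ≤
        ∫ r in A..B, 2 * (B - M) ^ 2 * (Kd ^ 2 + K0 ^ 2) *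
          (F r θ φ ^ 2 + T r θ φ ^ 2 + D r θ φ ^ 2) := by
      refine intervalIntegral.integral_mono_on hAB.le (cwg.intervalIntegrable A B)
        ((continuous_const.mul (((cFr.pow 2).add (cTr.pow 2)).add (cDr.pow 2))).intervalIntegrable
          _ _) fun r hr ↦ ?_
      have hK0r := hK0 r hr
      have hKdr := hKd r hr
      rw [Real.norm_eq_abs] at hK0r hKdr
      have a1 : deriv η r ^ 2 ≤ Kd ^ 2 := by
        have h := abs_le.mp hKdr
        exact sq_le_sq' h.1 h.2
      have a2 : η r ^ 2 ≤ K0 ^ 2 := by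
        have h := abs_le.mp hK0r
        exact sq_le_sq' h.1 h.2
      have hx := sq_nonneg (F r θ φ)
      have hy := sq_nonneg (D r θ φ)
      have hz := sq_nonneg (T r θ φ)
      have s1 : (deriv η r * F r θ φ + η r * D r θ φ) ^ 2 ≤
          2 * (deriv η r ^ 2 * F r θ φ ^ 2 + η r ^ 2 * D r θ φ ^ 2) := by
        nlinarith only [sq_nonneg (deriv η r * F r θ φ - η r * D r θ φ)]
      have s2 : deriv η r ^ 2 * F r θ φ ^ 2 ≤ Kd ^ 2 * F r θ φ ^ 2 :=
        mul_le_mul_of_nonneg_right a1 hx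
      have s3 : η r ^ 2 * D r θ φ ^ 2 ≤ K0 ^ 2 * D r θ φ ^ 2 :=
        mul_le_mul_of_nonneg_right a2 hy
      have s4 : (r - M) ^ 2 ≤ (B - M) ^ 2 :=
        pow_le_pow_left₀ (by linarith [hr.1]) (by linarith [hr.2]) 2
      have t1 : (r - M) ^ 2 * (deriv η r * F r θ φ + η r * D r θ φ) ^ 2 ≤
          (B - M) ^ 2 * (2 * (Kd ^ 2 * F r θ φ ^ 2 + K0 ^ 2 * D r θ φ ^ 2)) :=
        mul_le_mul s4 (s1.trans (by linarith only [s2, s3])) (sq_nonneg _) (sq_nonneg _)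
      have p1 : 0 ≤ (B - M) ^ 2 * Kd ^ 2 * (T r θ φ ^ 2 + D r θ φ ^ 2) :=
        mul_nonneg (mul_nonneg (sq_nonneg _) (sq_nonneg _)) (add_nonneg hz hy)
      have p2 : 0 ≤ (B - M) ^ 2 * K0 ^ 2 * (F r θ φ ^ 2 + T r θ φ ^ 2) :=
        mul_nonneg (mul_nonneg (sq_nonneg _) (sq_nonneg _)) (add_nonneg hx hz)
      linarith only [t1, p1, p2]
    rw [intervalIntegral.integral_const_mul] at e4
    rw [e1, e2] at hH
    rw [hc]
    linarith only [hH, e3, e4]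
  /- ## integrate against `sin θ dθ dφ` -/
  have csin : Continuous fun q : ℝ × ℝ × ℝ ↦ sin q.2.1 := by fun_prop
  have cf : Continuous fun q : ℝ × ℝ × ℝ ↦ sin q.2.1 * F q.1 q.2.1 q.2.2 ^ 2 := csin.mul (cF.pow 2)
  have cg₁ : Continuous fun q : ℝ × ℝ × ℝ ↦
      4 * (sin q.2.1 * ((q.1 - M) ^ 2 * D q.1 q.2.1 q.2.2 ^ 2)) :=
    continuous_const.mul (csin.mul (((continuous_fst.sub continuous_const).pow 2).mul (cD.pow 2)))
  have cg₂ : Continuous fun q : ℝ × ℝ × ℝ ↦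
      c * (sin q.2.1 * (F q.1 q.2.1 q.2.2 ^ 2 + T q.1 q.2.1 q.2.2 ^ 2 + D q.1 q.2.1 q.2.2 ^ 2)) :=
    continuous_const.mul (csin.mul (((cF.pow 2).add (cT.pow 2)).add (cD.pow 2)))
  have key : shellIntegral M A (fun r θ φ ↦ sin θ * F r θ φ ^ 2) ≤
      shellIntegral M A (fun r θ φ ↦ 4 * (sin θ * ((r - M) ^ 2 * D r θ φ ^ 2))) +
        shellIntegral A B (fun r θ φ ↦
          c * (sin θ * (F r θ φ ^ 2 + T r θ φ ^ 2 + D r θ φ ^ 2))) := by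
    unfold shellIntegral
    have cif := continuous_inner_of_continuous (R₁ := M) (R₂ := A)
      (g := fun r θ φ ↦ sin θ * F r θ φ ^ 2) cf
    have ci₁ := continuous_inner_of_continuous (R₁ := M) (R₂ := A)
      (g := fun r θ φ ↦ 4 * (sin θ * ((r - M) ^ 2 * D r θ φ ^ 2))) cg₁
    have ci₂ := continuous_inner_of_continuous (R₁ := A) (R₂ := B)
      (g := fun r θ φ ↦ c * (sin θ * (F r θ φ ^ 2 + T r θ φ ^ 2 + D r θ φ ^ 2))) cg₂
    have ci₁₂ : Continuous (Function.uncurry fun θ φ ↦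
        (∫ r in M..A, 4 * (sin θ * ((r - M) ^ 2 * D r θ φ ^ 2))) +
          ∫ r in A..B, c * (sin θ * (F r θ φ ^ 2 + T r θ φ ^ 2 + D r θ φ ^ 2))) := by
      exact ci₁.add ci₂
    rw [← sphereIntegral_add ci₁ ci₂]
    refine sphereIntegral_mono_on cif ci₁₂ fun θ hθ φ _ ↦ ?_
    have hs : 0 ≤ sin θ := sin_nonneg_of_nonneg_of_le_pi hθ.1 hθ.2
    have l1 : (∫ r in M..A, sin θ * F r θ φ ^ 2) = sin θ * ∫ r in M..A, F r θ φ ^ 2 :=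
      intervalIntegral.integral_const_mul _ _
    have l2 : (∫ r in M..A, 4 * (sin θ * ((r - M) ^ 2 * D r θ φ ^ 2))) =
        4 * (sin θ * ∫ r in M..A, (r - M) ^ 2 * D r θ φ ^ 2) := by
      rw [intervalIntegral.integral_const_mul, intervalIntegral.integral_const_mul]
    have l3 : (∫ r in A..B, c * (sin θ * (F r θ φ ^ 2 + T r θ φ ^ 2 + D r θ φ ^ 2))) =
        c * (sin θ * ∫ r in A..B, (F r θ φ ^ 2 + T r θ φ ^ 2 + D r θ φ ^ 2)) := by
      rw [intervalIntegral.integral_const_mul, intervalIntegral.integral_const_mul]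
    show (∫ r in M..A, sin θ * F r θ φ ^ 2) ≤
      (∫ r in M..A, 4 * (sin θ * ((r - M) ^ 2 * D r θ φ ^ 2))) +
        ∫ r in A..B, c * (sin θ * (F r θ φ ^ 2 + T r θ φ ^ 2 + D r θ φ ^ 2))
    rw [l1, l2, l3]
    have h := mul_le_mul_of_nonneg_left (h1D θ φ) hs
    linarith only [h]
  rw [shellIntegral_const_mul, shellIntegral_const_mul] at key
  simpa only [hF, hD, hT] using key

variable [Kerr.Facts] [Kerr.SliceFacts] {M r₀ : ℝ} {U₀ : Set (Kerr.region M r₀)} {Φ : E4 → ℝ}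

/-- **Aretakis 2012, Cor. 13.2.1 for the class: the zeroth-order term on the collar from the
three-term integrated decay in a transition shell.** Under the hypotheses of
`collar_timeIntegral_degRhoDeriv_sq_le_of_transitionILED₃` there is `C` with
`∫₀^τ ∫₀^{2π}∫₀^π∫_M^A sin θ Φ(p(t, r, θ, φ))² dt ≤ C` for all `τ ≥ 0`: the cut-off Hardy
inequality `shellIntegral_sq_le_cutoffHardy` on every leaf, the degenerate transversal term by
`collar_timeIntegral_degRhoDeriv_sq_le_of_transitionILED₃`, and the error in the shell by the
hypothesis. [cite: Aretakis2012, §13.2 (Cor. 13.2.1) and §4.4 (Prop. 4.4.1)] -/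
theorem collar_timeIntegral_sq_le_of_transitionILED₃ (hM : 0 < M)
    (hr₀ : r₀ ∈ Set.Ioo 0 M) (hU₀ : IsOpen U₀)
    (hKU : {x : Kerr.region M r₀ | Kerr.rPlus M M ≤ Kerr.radius M (x : E4) ∧ 0 ≤ (x : E4) 0} ⊆ U₀)
    (hΦ : ContDiff ℝ ∞ Φ)
    (haxi : ∀ (β : ℝ) (z : E4), Φ (E4.axialRotation β z) = Φ z)
    (hsol : ∀ x ∈ U₀, (Kerr.smoothMetric M M r₀).toPseudoRiemannianMetric.dalembertian
      (fun y : Kerr.region M r₀ ↦ Φ y) x = 0)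
    {ρ : ℝ} (hloc : ∀ x ∈ U₀, (x : E4) 0 = 0 → ρ < E4.spatialNorm (x : E4) →
      Φ x = 0 ∧ fderiv ℝ Φ x = 0)
    {A B I : ℝ} (hMA : M < A) (hAB : A < B) (hA23 : A ≤ 23 / 21 * M)
    (hI : ∀ τ : ℝ, 0 ≤ τ → (∫ t in (0 : ℝ)..τ, shellIntegral A B (fun r θ φ ↦ sin θ *
        (Φ (shellPoint M t r θ φ) ^ 2 +
          (fderiv ℝ Φ (shellPoint M t r θ φ) (E4.basisVector 0)) ^ 2 +
          (fderiv ℝ Φ (shellPoint M t r θ φ) (E4.spaceEmbed (sphRadial θ φ))) ^ 2))) ≤ I) :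
    ∃ C : ℝ, ∀ τ : ℝ, 0 ≤ τ →
      (∫ t in (0 : ℝ)..τ, shellIntegral M A (fun r θ φ ↦ sin θ *
        Φ (shellPoint M t r θ φ) ^ 2)) ≤ C := by
  have hΦ1 : ContDiff ℝ 1 Φ := hΦ.of_le (by exact_mod_cast le_top)
  obtain ⟨C₁, hC₁⟩ := collar_timeIntegral_degRhoDeriv_sq_le_of_transitionILED₃ hM hr₀ hU₀ hKU hΦ
    haxi hsol hloc hMA hAB hA23 hI
  obtain ⟨c, hc0, hc⟩ := shellIntegral_sq_le_cutoffHardy hMA.le hAB hΦ1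
  refine ⟨4 * C₁ + c * I, fun τ hτ ↦ ?_⟩
  -- the three time-dependent shell integrals and their continuity
  obtain ⟨S₀, hS₀⟩ : ∃ S₀ : ℝ → ℝ, S₀ = fun t ↦ shellIntegral M A (fun r θ φ ↦ sin θ *
      Φ (shellPoint M t r θ φ) ^ 2) := ⟨_, rfl⟩
  obtain ⟨S₁, hS₁⟩ : ∃ S₁ : ℝ → ℝ, S₁ = fun t ↦ shellIntegral M A (fun r θ φ ↦ sin θ * ((r - M) ^ 2 *
      (fderiv ℝ Φ (shellPoint M t r θ φ) (E4.spaceEmbed (sphRadial θ φ))) ^ 2)) := ⟨_, rfl⟩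
  obtain ⟨S₂, hS₂⟩ : ∃ S₂ : ℝ → ℝ, S₂ = fun t ↦ shellIntegral A B (fun r θ φ ↦ sin θ *
      (Φ (shellPoint M t r θ φ) ^ 2 +
        (fderiv ℝ Φ (shellPoint M t r θ φ) (E4.basisVector 0)) ^ 2 +
        (fderiv ℝ Φ (shellPoint M t r θ φ) (E4.spaceEmbed (sphRadial θ φ))) ^ 2)) := ⟨_, rfl⟩
  have cΦ4 : Continuous fun q : ℝ × ℝ × ℝ × ℝ ↦ Φ (shellPoint M q.1 q.2.1 q.2.2.1 q.2.2.2) :=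
    hΦ.continuous.comp (continuous_shellPoint₄ M)
  have cD4 := continuous_rhoDeriv_shellPoint₄ hΦ1 M
  have cT4 : Continuous fun q : ℝ × ℝ × ℝ × ℝ ↦
      fderiv ℝ Φ (shellPoint M q.1 q.2.1 q.2.2.1 q.2.2.2) (E4.basisVector 0) :=
    ((hΦ1.continuous_fderiv one_ne_zero).comp (continuous_shellPoint₄ M)).clm_apply continuous_const
  have csin : Continuous fun q : ℝ × ℝ × ℝ × ℝ ↦ sin q.2.2.1 := by fun_prop
  have crM : Continuous fun q : ℝ × ℝ × ℝ × ℝ ↦ (q.2.1 - M) ^ 2 := by fun_prop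
  have cS₀ : Continuous S₀ := by
    rw [hS₀]; exact continuous_shellIntegral (csin.mul (cΦ4.pow 2))
  have cS₁ : Continuous S₁ := by
    rw [hS₁]; exact continuous_shellIntegral (csin.mul (crM.mul (cD4.pow 2)))
  have cS₂ : Continuous S₂ := by
    rw [hS₂]; exact continuous_shellIntegral (csin.mul (((cΦ4.pow 2).add (cT4.pow 2)).add (cD4.pow 2)))
  have hdom : ∀ t, S₀ t ≤ 4 * S₁ t + c * S₂ t := fun t ↦ by
    rw [hS₀, hS₁, hS₂]; exact hc t
  have hi1 : IntervalIntegrable (fun t ↦ 4 * S₁ t) volume 0 τ :=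
    (continuous_const.mul cS₁).intervalIntegrable _ _
  have hi2 : IntervalIntegrable (fun t ↦ c * S₂ t) volume 0 τ :=
    (continuous_const.mul cS₂).intervalIntegrable _ _
  have hmono : (∫ t in (0 : ℝ)..τ, S₀ t) ≤ ∫ t in (0 : ℝ)..τ, (4 * S₁ t + c * S₂ t) :=
    intervalIntegral.integral_mono_on hτ (cS₀.intervalIntegrable _ _) (hi1.add hi2)
      fun t _ ↦ hdom t
  rw [intervalIntegral.integral_add hi1 hi2, intervalIntegral.integral_const_mul,
    intervalIntegral.integral_const_mul] at hmono
  have h1 : (∫ t in (0 : ℝ)..τ, S₁ t) ≤ C₁ := by rw [hS₁]; exact hC₁ τ hτ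
  have h2 : (∫ t in (0 : ℝ)..τ, S₂ t) ≤ I := by rw [hS₂]; exact hI τ hτ
  have h2' := mul_le_mul_of_nonneg_left h2 hc0
  have hgoal : (∫ t in (0 : ℝ)..τ, S₀ t) ≤ 4 * C₁ + c * I := by linarith only [hmono, h1, h2']
  rw [hS₀] at hgoal
  exact hgoal

/-! ### Integrability on `(0, ∞)` of the near-horizon shell integral -/

/-- **Aretakis 2012, Thms. 1–2 in shell form for the class, from the three-term integrated decay in
a transition shell**: under the hypotheses of
`collar_timeIntegral_degRhoDeriv_sq_le_of_transitionILED₃`,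
`τ ↦ ∫₀^{2π}∫₀^π∫_M^A sin θ (Φ² + (r − M)²(∂_ρΦ)²)(p(τ, r, θ, φ))` is integrable on `(0, ∞)` —
the shape of the child fact `Aretakis2012_integratedDecay` with `R₂ = A`, `τ₀ = 0`.
[cite: Aretakis2012, §3 (Thms. 1, 2) and §13.1–13.2] -/
theorem integrableOn_nearHorizonShell_of_transitionILED₃ (hM : 0 < M)
    (hr₀ : r₀ ∈ Set.Ioo 0 M) (hU₀ : IsOpen U₀)
    (hKU : {x : Kerr.region M r₀ | Kerr.rPlus M M ≤ Kerr.radius M (x : E4) ∧ 0 ≤ (x : E4) 0} ⊆ U₀)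
    (hΦ : ContDiff ℝ ∞ Φ)
    (haxi : ∀ (β : ℝ) (z : E4), Φ (E4.axialRotation β z) = Φ z)
    (hsol : ∀ x ∈ U₀, (Kerr.smoothMetric M M r₀).toPseudoRiemannianMetric.dalembertian
      (fun y : Kerr.region M r₀ ↦ Φ y) x = 0)
    {ρ : ℝ} (hloc : ∀ x ∈ U₀, (x : E4) 0 = 0 → ρ < E4.spatialNorm (x : E4) →
      Φ x = 0 ∧ fderiv ℝ Φ x = 0)
    {A B I : ℝ} (hMA : M < A) (hAB : A < B) (hA23 : A ≤ 23 / 21 * M)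
    (hI : ∀ τ : ℝ, 0 ≤ τ → (∫ t in (0 : ℝ)..τ, shellIntegral A B (fun r θ φ ↦ sin θ *
        (Φ (shellPoint M t r θ φ) ^ 2 +
          (fderiv ℝ Φ (shellPoint M t r θ φ) (E4.basisVector 0)) ^ 2 +
          (fderiv ℝ Φ (shellPoint M t r θ φ) (E4.spaceEmbed (sphRadial θ φ))) ^ 2))) ≤ I) :
    IntegrableOn (fun τ ↦ shellIntegral M A (fun r θ φ ↦ sin θ *
      (Φ (shellPoint M τ r θ φ) ^ 2 + (r - M) ^ 2 *
        (fderiv ℝ Φ (shellPoint M τ r θ φ) (E4.spaceEmbed (sphRadial θ φ))) ^ 2))) (Ioi 0) := by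
  have hΦ1 : ContDiff ℝ 1 Φ := hΦ.of_le (by exact_mod_cast le_top)
  obtain ⟨C₁, hC₁⟩ := collar_timeIntegral_degRhoDeriv_sq_le_of_transitionILED₃ hM hr₀ hU₀ hKU hΦ
    haxi hsol hloc hMA hAB hA23 hI
  obtain ⟨C₀, hC₀⟩ := collar_timeIntegral_sq_le_of_transitionILED₃ hM hr₀ hU₀ hKU hΦ
    haxi hsol hloc hMA hAB hA23 hI
  -- the two pieces and their sum
  obtain ⟨S₀, hS₀⟩ : ∃ S₀ : ℝ → ℝ, S₀ = fun t ↦ shellIntegral M A (fun r θ φ ↦ sin θ *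
      Φ (shellPoint M t r θ φ) ^ 2) := ⟨_, rfl⟩
  obtain ⟨S₁, hS₁⟩ : ∃ S₁ : ℝ → ℝ, S₁ = fun t ↦ shellIntegral M A (fun r θ φ ↦ sin θ * ((r - M) ^ 2 *
      (fderiv ℝ Φ (shellPoint M t r θ φ) (E4.spaceEmbed (sphRadial θ φ))) ^ 2)) := ⟨_, rfl⟩
  have cΦ4 : Continuous fun q : ℝ × ℝ × ℝ × ℝ ↦ Φ (shellPoint M q.1 q.2.1 q.2.2.1 q.2.2.2) :=
    hΦ.continuous.comp (continuous_shellPoint₄ M)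
  have cD4 := continuous_rhoDeriv_shellPoint₄ hΦ1 M
  have csin : Continuous fun q : ℝ × ℝ × ℝ × ℝ ↦ sin q.2.2.1 := by fun_prop
  have crM : Continuous fun q : ℝ × ℝ × ℝ × ℝ ↦ (q.2.1 - M) ^ 2 := by fun_prop
  have cS₀ : Continuous S₀ := by
    rw [hS₀]; exact continuous_shellIntegral (csin.mul (cΦ4.pow 2))
  have cS₁ : Continuous S₁ := by
    rw [hS₁]; exact continuous_shellIntegral (csin.mul (crM.mul (cD4.pow 2)))
  -- the integrand of the statement is `S₀ + S₁`, continuous and non-negative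
  have hsum : (fun τ ↦ shellIntegral M A (fun r θ φ ↦ sin θ *
      (Φ (shellPoint M τ r θ φ) ^ 2 + (r - M) ^ 2 *
        (fderiv ℝ Φ (shellPoint M τ r θ φ) (E4.spaceEmbed (sphRadial θ φ))) ^ 2))) =
      fun τ ↦ S₀ τ + S₁ τ := by
    funext τ
    have c3 : ∀ {H : ℝ → ℝ → ℝ → ℝ → ℝ}, (Continuous fun q : ℝ × ℝ × ℝ × ℝ ↦ H q.1 q.2.1 q.2.2.1 q.2.2.2) →
        Continuous fun q : ℝ × ℝ × ℝ ↦ H τ q.1 q.2.1 q.2.2 := by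
      intro H hH
      have hc1 : Continuous fun x : ℝ × ℝ × ℝ ↦ ((τ, x.1, x.2.1, x.2.2) : ℝ × ℝ × ℝ × ℝ) := by fun_prop
      have hc2 := hH.comp hc1; rw [Function.comp_def] at hc2; exact hc2
    have cΦ3 := c3 (H := fun t r θ φ ↦ Φ (shellPoint M t r θ φ)) cΦ4
    have cD3 := c3 (H := fun t r θ φ ↦
      fderiv ℝ Φ (shellPoint M t r θ φ) (E4.spaceEmbed (sphRadial θ φ))) cD4
    have csin3 : Continuous fun q : ℝ × ℝ × ℝ ↦ sin q.2.1 := by fun_prop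
    have crM3 : Continuous fun q : ℝ × ℝ × ℝ ↦ (q.1 - M) ^ 2 := by fun_prop
    have hf : Continuous fun q : ℝ × ℝ × ℝ ↦ sin q.2.1 * Φ (shellPoint M τ q.1 q.2.1 q.2.2) ^ 2 :=
      csin3.mul (cΦ3.pow 2)
    have hg : Continuous fun q : ℝ × ℝ × ℝ ↦ sin q.2.1 * ((q.1 - M) ^ 2 *
        (fderiv ℝ Φ (shellPoint M τ q.1 q.2.1 q.2.2) (E4.spaceEmbed (sphRadial q.2.1 q.2.2))) ^ 2) :=
      csin3.mul (crM3.mul (cD3.pow 2))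
    have heq : (fun r θ φ ↦ sin θ *
        (Φ (shellPoint M τ r θ φ) ^ 2 + (r - M) ^ 2 *
          (fderiv ℝ Φ (shellPoint M τ r θ φ) (E4.spaceEmbed (sphRadial θ φ))) ^ 2)) =
        fun r θ φ ↦ sin θ * Φ (shellPoint M τ r θ φ) ^ 2 + sin θ * ((r - M) ^ 2 *
          (fderiv ℝ Φ (shellPoint M τ r θ φ) (E4.spaceEmbed (sphRadial θ φ))) ^ 2) := by
      funext r θ φ; ring
    rw [heq, shellIntegral_add hf hg, hS₀, hS₁]
  have hG0 : ∀ t, 0 ≤ S₀ t + S₁ t := by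
    intro t
    have h0 : 0 ≤ S₀ t := by
      rw [hS₀]
      refine shellIntegral_nonneg hMA.le ?_ fun r _ θ hθ φ _ ↦
        mul_nonneg (sin_nonneg_of_nonneg_of_le_pi hθ.1 hθ.2) (sq_nonneg _)
      exact (continuous_sin.comp (continuous_fst.comp continuous_snd)).mul
        ((hΦ.continuous.comp (continuous_shellPoint M t)).pow 2)
    have h1 : 0 ≤ S₁ t := by
      rw [hS₁]
      refine shellIntegral_nonneg hMA.le ?_ fun r _ θ hθ φ _ ↦
        mul_nonneg (sin_nonneg_of_nonneg_of_le_pi hθ.1 hθ.2) (mul_nonneg (sq_nonneg _) (sq_nonneg _))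
      exact (continuous_sin.comp (continuous_fst.comp continuous_snd)).mul
        (((continuous_fst.sub continuous_const).pow 2).mul
          ((((hΦ1.continuous_fderiv one_ne_zero).comp (continuous_shellPoint M t)).clm_apply
            (continuous_spaceEmbed_sphRadial.comp continuous_snd)).pow 2))
    exact add_nonneg h0 h1
  have hGC : ∀ τ : ℝ, 0 ≤ τ → (∫ t in (0 : ℝ)..τ, (S₀ t + S₁ t)) ≤ C₀ + C₁ := by
    intro τ hτ
    rw [intervalIntegral.integral_add (cS₀.intervalIntegrable _ _) (cS₁.intervalIntegrable _ _)]
    have h0 : (∫ t in (0 : ℝ)..τ, S₀ t) ≤ C₀ := by rw [hS₀]; exact hC₀ τ hτ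
    have h1 : (∫ t in (0 : ℝ)..τ, S₁ t) ≤ C₁ := by rw [hS₁]; exact hC₁ τ hτ
    exact add_le_add h0 h1
  rw [hsum]
  exact integrableOn_Ioi_of_intervalIntegral_le (cS₀.add cS₁) hG0 hGC

end ZerothOrder

end Literature.Barriers.FinalStateConjecture.Kerr

namespace Literature.Barriers.FinalStateConjecture

open Literature.Geometry.Lorentzian Kerr

/-- **`Aretakis2012_integratedDecay` from the three-term integrated decay in a transition shell.**
If for every member `Φ` of the class there are `M < A < B`, `A ≤ 23M/21`, and `I` with
`∫₀^τ ∫₀^{2π}∫₀^π∫_A^B sin θ (Φ² + (TΦ)² + (∂_ρΦ)²) dt ≤ I` for all `τ ≥ 0` (Prop. 12.5.1 of the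
source restricted to a thin shell near `𝓗⁺`), then `Aretakis2012_integratedDecay` holds (with
`R₂ = A`, `τ₀ = 0`): the near-horizon spacetime bound of Thm. 2 with the collar bulk kept, and
Cor. 13.2.1. The same hypothesis gives `Aretakis2012_uniformBoundedness`
(`Aretakis2012_uniformBoundedness_of_transitionILED₃`).
[cite: Aretakis2012, §3 (Thms. 1, 2), §12.5 (Prop. 12.5.1), §13.1–13.2] -/
theorem Aretakis2012_integratedDecay_of_transitionILED₃
    (Hiled : ∀ [Kerr.Facts] [Kerr.SliceFacts] (M : ℝ), 0 < M → ∀ r₀ ∈ Set.Ioo 0 M,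
      ∀ (U₀ : Set (Kerr.region M r₀)) (Φ : E4 → ℝ), IsOpen U₀ →
        {x : Kerr.region M r₀ | Kerr.rPlus M M ≤ Kerr.radius M (x : E4) ∧ 0 ≤ (x : E4) 0} ⊆ U₀ →
        ContDiff ℝ ∞ Φ →
        (∀ x ∈ U₀, (Kerr.smoothMetric M M r₀).toPseudoRiemannianMetric.dalembertian
          (fun y : Kerr.region M r₀ ↦ Φ y) x = 0) →
        (∃ ρ : ℝ, ∀ x ∈ U₀, (x : E4) 0 = 0 → ρ < E4.spatialNorm (x : E4) →
          Φ x = 0 ∧ fderiv ℝ Φ x = 0) →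
        (∀ (β : ℝ) (z : E4), Φ (E4.axialRotation β z) = Φ z) →
        ∃ A B I : ℝ, M < A ∧ A < B ∧ A ≤ 23 / 21 * M ∧ ∀ τ : ℝ, 0 ≤ τ →
          (∫ t in (0 : ℝ)..τ, Kerr.shellIntegral A B (fun r θ φ ↦ Real.sin θ *
            (Φ (Kerr.shellPoint M t r θ φ) ^ 2 +
              (fderiv ℝ Φ (Kerr.shellPoint M t r θ φ) (E4.basisVector 0)) ^ 2 +
              (fderiv ℝ Φ (Kerr.shellPoint M t r θ φ) (E4.spaceEmbed (sphRadial θ φ))) ^ 2))) ≤ I) :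
    Aretakis2012_integratedDecay := by
  intro _ _ M hM r₀ hr₀ U₀ Φ hU₀ hKU hΦ hsol hloc haxi
  obtain ⟨A, B, I, hMA, hAB, hA23, hI⟩ := Hiled M hM r₀ hr₀ U₀ Φ hU₀ hKU hΦ hsol hloc haxi
  obtain ⟨ρ, hρ⟩ := hloc
  exact ⟨A, 0, hMA, integrableOn_nearHorizonShell_of_transitionILED₃ hM hr₀ hU₀ hKU hΦ haxi hsol
    hρ hMA hAB hA23 hI⟩

/-- **The parent `Aretakis2012_pointwiseDecay` (Thm. 5 of the source) from the three-term
integrated decay in a transition shell alone** (both children from the one hypothesis, then the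
proved assembly `Aretakis2012_pointwiseDecay_holds_of`).
[cite: Aretakis2012, §3 (Thms. 1, 2, 5), §13, §15] -/
theorem Aretakis2012_pointwiseDecay_of_transitionILED₃
    (Hiled : ∀ [Kerr.Facts] [Kerr.SliceFacts] (M : ℝ), 0 < M → ∀ r₀ ∈ Set.Ioo 0 M,
      ∀ (U₀ : Set (Kerr.region M r₀)) (Φ : E4 → ℝ), IsOpen U₀ →
        {x : Kerr.region M r₀ | Kerr.rPlus M M ≤ Kerr.radius M (x : E4) ∧ 0 ≤ (x : E4) 0} ⊆ U₀ →
        ContDiff ℝ ∞ Φ →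
        (∀ x ∈ U₀, (Kerr.smoothMetric M M r₀).toPseudoRiemannianMetric.dalembertian
          (fun y : Kerr.region M r₀ ↦ Φ y) x = 0) →
        (∃ ρ : ℝ, ∀ x ∈ U₀, (x : E4) 0 = 0 → ρ < E4.spatialNorm (x : E4) →
          Φ x = 0 ∧ fderiv ℝ Φ x = 0) →
        (∀ (β : ℝ) (z : E4), Φ (E4.axialRotation β z) = Φ z) →
        ∃ A B I : ℝ, M < A ∧ A < B ∧ A ≤ 23 / 21 * M ∧ ∀ τ : ℝ, 0 ≤ τ →
          (∫ t in (0 : ℝ)..τ, Kerr.shellIntegral A B (fun r θ φ ↦ Real.sin θ *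
            (Φ (Kerr.shellPoint M t r θ φ) ^ 2 +
              (fderiv ℝ Φ (Kerr.shellPoint M t r θ φ) (E4.basisVector 0)) ^ 2 +
              (fderiv ℝ Φ (Kerr.shellPoint M t r θ φ) (E4.spaceEmbed (sphRadial θ φ))) ^ 2))) ≤ I) :
    Aretakis2012_pointwiseDecay :=
  Aretakis2012_pointwiseDecay_holds_of (Aretakis2012_uniformBoundedness_of_transitionILED₃ Hiled)
    (Aretakis2012_integratedDecay_of_transitionILED₃ Hiled)

end Literature.Barriers.FinalStateConjecture

end
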